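import Summits.QuantumFields.YangMills.Theorems.BalabanUVNodesN24Stub23VWShareK1AxV11
import Summits.QuantumFields.YangMills.Theorems.BalabanUVNodesK1AxV11Roads
import Summits.QuantumFields.YangMills.Theorems.BalabanUVNodesK1RunwiseLettersOfBoxHAtRecord
import Summits.QuantumFields.YangMills.Theorems.BalabanUVNodesN09NestingOfHierAxialAtRecordAx
import Summits.QuantumFields.YangMills.Theses.BalabanUVNodes
import Summits.QuantumFields.YangMills.Theorems.BalabanUVNodesN11K1ZBRoadDoorRowsChi
import Summits.QuantumFields.YangMills.Theorems.BalabanUVNodesN13UV01LevelZeroAtThm1CCMWZBAxOfPrintedZ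
import Literature.MathematicalPhysics.QuantumFieldTheory.Balaban1983to89.Node00.Record13LettersOfThm1CCMWZBChi
import Literature.MathematicalPhysics.QuantumFieldTheory.Balaban1983to89.Node00.Record13SepCoPRInhabitedOfSepCoPChi
import Summits.QuantumFields.YangMills.Theorems.BalabanUVNodesK0AllTorusOfStepTokensGuardedZBLamAx
import Summits.QuantumFields.YangMills.Theorems.BalabanUVNodesK0AllTorusOfStepTokensGuardedZBLamPrintAx
import Summits.QuantumFields.YangMills.Theorems.BalabanUVNodesK0V23Stub3NonVacuity
import Summits.QuantumFields.YangMills.Theorems.BalabanUVNodesK1RunRowsBoxCongrAxAtAxWitness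
import Summits.QuantumFields.YangMills.Theorems.BalabanUVNodesK1RunwiseLettersOfBoxH

/-!
# NODE N24 (B2) — THE LINE-2′ ENGINE, EDITION «N09T-Ax» (N09's Theorem-3 MEMBER replaced by N09's LOCATED INPUT ROWS through g23's Ax door ✓p812325): K1ᴬ `StabilityBRunRowsAtRecordR13SepCoPHVAx` (stmt-QuantumFields-27239) BY ITS ROUTE NAME THROUGH THE THREE REGISTERED LINE-2′ STUBS' TEXTS
# (v11.1 1c0150ff21ca0f8d: `stub_nodes13PWSVW` ∕ `stub_runRows13PWSVW` ∕ `stub_cont13VW`) AT THE WITNESS OF RECORD — the Ax Gauss pin of the printed-z member on the COFINAL β-SOCKET,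
# exactly the witness, the socket, the prelude and the node binders of the K1ᴬ ENGINE Ax ✓p811182 (`…N24K1R9ByNameOfCofinalBetaSocketV23GridGBChildrenSplitSlot8Thm1AEPosAtGaussPinPrintedZBYAx`)

TRACK A (YM-PLAN §2d, node N24 of 28 = binder B2, COMPOSITE), seat `pub-ymgap-dag-n24-c` (gen 24; the -a hand on LINE 2′, dag-lead g41 hands lever `stub_nodes13PWSVW`; `--supports
stmt-QuantumFields-27239 --as helper`, count-neutral).  dag-lead `K1AX-V11-LINE-TABLE` v4.x θ-OF-RECORD: «build the rung-1 witness through the pointed assembler AT THE LIVE RE-PIN» — the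
engine's witness `gaussPinH (ofHistoryBlind ⟨theta13OfThm1CCMWZBAx …, ZrOfRecord₁₃Ax …⟩) χ⋆` IS on the re-pin (dag-n12-d g37 probe, `rfl`).

WHAT THIS FILE IS.  The ENGINE Ax's §1 (its statement's binders and its prelude BYTE-KEPT: `8 ≤ L`, stub 1ᴮ's radius, the socket at `min ā (1∕(109824·L²))`, the census `rfl`, the window letters,
def-Y's Ax box transport, this seat's Ax run-rows congruence, n07-w3's grid-guard provisos, dag-n11-d's χ door rows + `h11`, N13's level 0 at the printed z, the displayed a.e. rows, `em ∕ ep := max`)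
= the LINE-2′ engine ✓p814157 BYTE-KEPT with ONE more declared edit (0) `h09TF` ∕ `h09T` (the displayed OUTPUT `∃ γ₉>0, ∀ w on the re-centred datum, w.γ ≤ γ₉ → ∀ P, smallCouplings → smallFieldInductive`) GONE →
`h09RF` ∕ `h09R` = the FOURTEEN LOCATED INPUT ROWS of `…N09NestingOfHierAxialAtRecordAx.h09T_recordAx_of_hierAxial_of_reg8_of_suppPt` at an abstract tuple `θN` PINNED TO THE WITNESS by `θN = Θ` (`hreg8` [B11] Thm 1 regularity on
the domains, `hle`∕`hεreg`, `haxbg` hierarchical axiality of the background along `contourOfRecord`, `hχregpt` the support property of the re-centred cut-off, `hint` integrability, `h11`∕`hres`∕`huniq` [B12]'s minimiser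
rows, the numerics `hεχ hε hε3 hε2 hε₀`), read at `θN := Θ`, `rfl`, and the member DERIVED inside (`γ₉ := 1`); plus (U)'s three: (1) `Slot8` GONE — LINE 2′'s S-bound world forces N05's leaf to be the REPAIRED SURVIVING SLOT, so `h05F` concludes `B8LeafOfRecordSubBH θ₃ λ₈`; (2) NEW binder `h12F`
(rung 1ⱽᵂ's N12 PIN: a residual W-layer with a genuine step and [IV]'s basic step at `WOfRecord₁₃Ax` on the window runs, AT THE WITNESS — dag-n12-d's currency; payable there by
`…N12BillH12ForStub1VWK1AxV11OfJunctionRows` modulo N12's junction rows); (3) the final `exact` of the Y0-χ consequent REPLACED by the LINE-2′ chain: `…N24Stub1VWShareK1AxV11AERow.N24_rung1VW_bodyAt_of_bills_at_aeRow`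
(✓p813787; ceiling letter `βup := max β′ (−(−β′))`) → `…N24Stub23VWShareK1AxV11.N24_runRowsContAtSomeRecord13PWSVW_of_bodyAt_of_rows_of_cont` (✓p813862; rows (i)(ii)(iii) FROM THE BOX —
`b := 0`, `r := max β′ β′` by n07-w3's `runConstRemainder_zero_of_boxH'`, `B := 0` —, (iv) + (C) NODE O's from the socket at the cut level `min γ γ₁`) → `k1AxBodyAt_of_runRowsContAtSomeRecord13PWSVW`
(the kit's W-END road `K1AxV11Defs.endStatementBPrinted_window_of_recordSV_of_nodesW_of_runLetters`, ✓p812918) → K1ᴬ's body at `F`; §2 = K1ᴬ BY ITS ROUTE NAME (`intro F _; exact §1 …`).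

WHICH CHILD BLOCKS K1ᴬ ON LINE 2′ AT THE WITNESS OF RECORD (kernel form = §2's hypotheses; = the ENGINE Ax's list PLUS `h12F`, with `h05F` in S-form and N09's MEMBER replaced by its INPUT ROWS `h09RF`): K0ᴬ ⊕ NODE O = `hβc` (the cofinal
β-socket at the Ax β) · N05 `h05F` (S-form) · N06 `h06F` (SOCKET, junk-inhabitable, V-555) · N07 `h07` · N08 `h08` · N09 `h09F` + `h09RF` (fourteen located input rows; the Thm-3 member derived by g23's Ax door v2) · N10 `h10F` · N11 `h11N` · N12 `h12F` (NEW: the rung's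
pin) · N13 `h13posF` + `hEfl` · `0 < ε`.  Discharged inside, as in the engine: the witness's provisos ∕ admissibility ∕ unity ∧ slots ∕ (R₁₃) laws (door rows), N13's level 0, rows (i)–(iii).
HONEST FRAMING.  Composition BY NAME on green homes; NO estimate of Bałaban's proved here; every family DISPLAYED (CONDITIONAL, audit `proof.conditional`); no registered stub closed (the three texts are
obtained AT THIS WITNESS under the displayed bills, not outright); K0ᴬ ∕ K1ᴬ (DECIDING) ∕ K3ᴬ OPEN (K1ᴬ v11.1 0∕6); counts UNMOVED (discharged 8∕27 · K 1∕4); one finite 𝕋⁴ programme at fixed ε,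
Bałaban AS PRINTED; R4 = the conditional finite-𝕋⁴ rung `BalabanLadder.UV` only; NOT continuum ∕ ℝ⁴ ∕ OS; NOT the Yang–Mills mass gap (Clay).  No `sorry`, `def`, `instance`, `notation`.
References (bookkeeping only): [Balaban1989LargeFieldII] Thm 1 p.355, (0.1) pp.355–356, (0.15) p.360, p.391; [Balaban1988Convergent] Cor. 3 (2.50) p.264, (0.2) p.244, (3.16)–(3.25) pp.268–270;
[Balaban1987RG1] Thm 3 p.264, (1.20)–(1.22) p.264, §1 pp.263–264, (2.9) p.266; [Balaban1989LargeFieldI] (0.2)–(0.6) p.176, Prop. 1 p.194; [Balaban1985RegularSpaces] Thm 8 p.101; [Balaban1985Variational] Thm 1 p.279.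
-/

noncomputable section

open scoped Matrix.Norms.L2Operator BigOperators
open Filter Topology MeasureTheory

namespace Summit.QuantumFields.YangMills.BalabanUVNodes.N24K1AxLine2VWN09TAxAtCofinalBetaSocketGaussPinPrintedZBY

open Literature.MathematicalPhysics.QuantumFieldTheory.Balaban1983to89
open Literature.MathematicalPhysics.QuantumFieldTheory.Balaban1983to89.Node00
open DagBinding T4Continuum T4DatumAssembly FlowStepRuns AveragingRT
open FlowStep (HBeta RGEqH prefixOf prefixOf_apply BetaLowerH BetaUpperH Box mem_box clampPrefix Y)
open Summit.QuantumFields.YangMills.Theorems.K0V23Stub3NonVacuity (exists_radius_antecedentsZB_inhabited_below)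
open Summit.QuantumFields.YangMills.Theorems.K1RunwiseLettersOfBoxH (windowLetters_of_absBoxH)
open Summit.QuantumFields.YangMills.Theorems.K1RunRowsBoxCongrAxAtAxWitness (runRows_theta13OfThm1CCMWZBAx_window_of_half)
open Summit.QuantumFields.YangMills.Theorems.K0AllTorusOfStepTokensGuardedZBLamAx (provisos₁₃SepCoP_theta13OfThm1CCMWZBAx_gridGuard_of_thm1RegSepCoP7MGB_of_thm1GaugeGB_lam hDat_dataSmall7LamTopOfAx hseamAx_rfl)
open Summit.QuantumFields.YangMills.Theorems.BalabanUVNodesN11GaussianCertificateDefsChi (gaussPinH)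
open Summit.QuantumFields.YangMills.Theorems.BalabanUVNodesN11Sect3SupplyChainDefsChi (Sect3Supplier)
open Summit.QuantumFields.YangMills.Theorems.BalabanUVNodesN11Sect3SupplyChainObligationsDefsChi (SupplierObligations OperandRowsAlongChain)
open Summit.QuantumFields.YangMills.Theorems.BalabanUVNodesN11K1ZBRoadDoorRowsChi (doorRows_gaussPinH_ofHistoryBlind_theta13OfThm1CCMWZB h11Family_gaussPinH_ofHistoryBlind_theta13OfThm1CCMWZB_of_exists_supplier_windowed)
open Summit.QuantumFields.YangMills.Theorems.K1RunwiseLettersOfBoxHAtRecord (runConstRemainder_zero_of_boxH')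
open Summit.QuantumFields.YangMills.BalabanUVNodes.N17RunRemAtOfShiftAnchorLevel (survCont_anti)
open Summit.QuantumFields.YangMills.Theorems.BalabanUVNodesK2NamedJetsRunRemAt (RunConstRemainder SurvCont)
open Summit.QuantumFields.YangMills.Theorems.K1AxV11Defs (RecordSV RunRowsContAtSomeRecord13PWSVW endStatementBPrinted_window_of_recordSV_of_nodesW_of_runLetters)
open Summit.QuantumFields.YangMills.BalabanUVNodes.N24Stub1VWShareK1AxV11AERow (N24_rung1VW_bodyAt_of_bills_at_aeRow)
open Summit.QuantumFields.YangMills.BalabanUVNodes.N24Stub23VWShareK1AxV11 (N24_runRowsContAtSomeRecord13PWSVW_of_bodyAt_of_rows_of_cont)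
open Summit.QuantumFields.YangMills.BalabanUVNodes.N09NestingOfHierAxialAtRecordAx (h09T_recordAx_of_hierAxial_of_reg8_of_suppPt)
open ExpMeanLog (deltaSU)
open Summit.QuantumFields.YangMills.BalabanUVNodes.N13UV01LevelZeroAtThm1CCMWZBAxOfPrintedZ (uv_zero_densOfRecord₁₃_theta13OfThm1CCMWZBAx_printedZ_of_eflAbs_of_inInterval_of_runPartialSumFloor chiβOfRecord₁₃Ax_mem_Icc)

variable {F : T4Family} {N : ℕ} [NeZero N]

/-! ## §1–§2. `N = 2`: K1ᴬ's consequent at `F` and K1ᴬ BY ITS ROUTE NAME on the COFINAL β-SOCKET at the Ax Gauss pin of the PRINTED-z member (slot road, N05 in S-form (`B8LeafOfRecordSubBH`; the engine's `Slot8` GONE); N09's Theorem-3 member displayed; N13 level 0 consumed, a.e. at levels ≥ 1 displayed) -/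

-- `k1AxBodyAt_of_runRowsContAtSomeRecord13PWSVW` (K1ᴬ's body at `F` from rung 2ⱽᵂ‴) is LANDED in the parent edition ✓p814157; inlined below (three lines) to keep this file off the parent's cone.

/-- **★★★ K1ᴬ's BODY AT `F` THROUGH LINE 2′ ON THE COFINAL β-SOCKET AT THE Ax GAUSS PIN OF THE PRINTED-z MEMBER** (the ENGINE Ax ✓p811182 §1's binders + `h12F`, `h05F` in S-form; its prelude byte-kept; the Y0-χ consequent replaced by the LINE-2′ chain rung 1ⱽᵂ → rung 2ⱽᵂ‴ → W-END road) — from the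
cofinal β-socket `hβc` (abs box of `betaOfRecord₁₃Ax F 2 θᶜᶜᴹᵂᶻᴮᴬˣ(j; ½; a₀; ε₀, ε₂₉; B₃, B₃′, a₀, a₁; Efl, logz)` on `]0, γ₀]` + NODE O's run rows (i) (iv) (C), at a producer radius below any prescribed one), the
road-free slot families (N05 in S-FORM, + N12 PIN `h12F`) READ AT the Ax Gauss pin `gaussPinH (ofHistoryBlind ⟨θᴬˣ, ZrOfRecord₁₃Ax θᴬˣ⟩) χ⋆`, `χ⋆ := chiFixed29Ax F 2 (numerics7OfThm1CCM F.L j ε₀ B₃ B₃' a₀ a₁) ε₂₉` (N05 at `Slot8`, N07, N08, N09's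
Lemma-4 leaf `h09F` and Theorem-3 MEMBER `h09TF` (edition «N09T-free»: the door's OUTPUT displayed — header), N10, N11's χ supplier `h11N`; N06 = the carrier-generic SOCKET `h06F`), the `Efl` volume bound
`hEfl`, N13's a.e. rows AT LEVELS ≥ 1 (`h13posF`).  PROOF = the parent ✓p782234 §1 under σ: stub 1ᴮ's radius, the socket at `min ā (1∕(109824·L²))`, the census `rfl`, window letters, def-Y's Ax box
transport, this seat's Ax run-rows congruence, n07-w3's Ax grid-guard provisos, dag-n11-d's χ door rows + `h11`, N13's level 0 at the Ax printed z (`chiβOfRecord₁₃Ax ∈ [0,1]`), the displayed a.e. rows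
(`em ∕ ep := max`), then — in place of the engine's ONE `exact` of the Y0-χ consequent — the LINE-2′ chain rung 1ⱽᵂ (✓p813787) → rung 2ⱽᵂ‴ (✓p813862) → the W-END road (✓p812918), with N09's Theorem-3 member fed from its fourteen located rows `h09RF … hP _ rfl` (g23's Ax door v2 ✓p812325 §5).  CONDITIONAL; nothing of Bałaban asserted; N09 ∕ N11 ∕ N13 NOT discharged.
[cite: Balaban1989LargeFieldII, Thm 1 p.355, (0.1) pp.355–356, (0.15) p.360, p.391; Balaban1988Convergent, Theorem p.245, Cor. 3 (2.50) p.264, (0.2) p.244, (1.15) p.249, (2.1) p.254, (2.5)–(2.8) pp.255–256, (3.16)–(3.25) pp.268–270, §3 p.279; Balaban1987RG1, (0.14)–(0.17) pp.254–255, (0.20) p.256, Thm 2 p.259, Thm 3 p.264, (1.20)–(1.22) p.264, §1 pp.263–264, (2.1)–(2.3) p.265, (2.9)–(2.10) pp.266–267; Balaban1985RegularSpaces, Prop. 7 (1.145) p.100, Thm 8 (1.146) p.101 (bookkeeping); Balaban1985Variational, Thm 1 (6), (8)–(10) p.279 and (181) p.307; Balaban1985Averaging, Prop. 2 (53) p.26]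 -/
theorem N24_k1AxBodyAt_line2VW_of_cofinalBetaSocketZBV23_of_childrenS_N12Pin_N09RowsAxDoorN11SupplierRowsThm1AEPos_atGaussPinPrintedZB (ε : ℝ) (hεz : 0 < ε)
    (Efl : ℕ → ℝ → ℝ → ℝ → ℝ → ℝ → ℝ → ℝ → B12.RunParams → ℕ → ℝ)
    (h05F : ∀ {j : ℕ} {γ ε₀ ε₂₉ B₃ B₃' a₀ a₁ : ℝ} (hγ₀ : 0 < γ) (hγh : γ ≤ 1 / 2) (hε : 0 < ε₀) (hε' : 0 < ε₂₉) (hB : 0 ≤ B₃) (hB' : 0 ≤ B₃') (ha₀ : 0 < a₀) (ha₁ : 0 < a₁) (ha₀ρ : a₀ ≤ 1 / (109824 * (F.L : ℝ) ^ 2)) (hε₀ρ : ε₀ = a₀) {bl β' : ℝ} (hbox : BetaLowerH bl γ (betaOfRecord₁₃Ax F 2 (theta13OfThm1CCMWZBAx F 2 j γ a₀ ε₀ ε₂₉ B₃ B₃' a₀ a₁ (Efl j γ ε₀ ε₂₉ B₃ B₃' a₀ a₁) (fun p i => Real.log (B16ZLower.zNorm (SU 2) (gOfRecord₁₃Ax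 F 2 (theta13OfThm1CCMWZBAx F 2 j γ a₀ ε₀ ε₂₉ B₃ B₃' a₀ a₁ (fun _ _ => 0) (fun _ _ => 0)) p i ^ 2) ε))))) (hbox' : BetaUpperH β' γ (betaOfRecord₁₃Ax F 2 (theta13OfThm1CCMWZBAx F 2 j γ a₀ ε₀ ε₂₉ B₃ B₃' a₀ a₁ (Efl j γ ε₀ ε₂₉ B₃ B₃' a₀ a₁) (fun p i => Real.log (B16ZLower.zNorm (SU 2) (gOfRecord₁₃Ax F 2 (theta13OfThm1CCMWZBAx F 2 j γ a₀ ε₀ ε₂₉ B₃ B₃' a₀ a₁ (fun _ _ => 0) (fun _ _ => 0)) p i ^ 2) ε))))) (hl : -bl * γ ^ 2 ≤ 3) (hβ' : β' * γ ^ 2 ≤ 3 / 4),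
      ∃ lam8 : ResidB8 (theta13OfThm1CCMWZBAx F 2 j γ a₀ ε₀ ε₂₉ B₃ B₃' a₀ a₁ (Efl j γ ε₀ ε₂₉ B₃ B₃' a₀ a₁) (fun p i => Real.log (B16ZLower.zNorm (SU 2) (gOfRecord₁₃Ax F 2 (theta13OfThm1CCMWZBAx F 2 j γ a₀ ε₀ ε₂₉ B₃ B₃' a₀ a₁ (fun _ _ => 0) (fun _ _ => 0)) p i ^ 2) ε))).toStage3Params, B8LeafOfRecordSubBH (theta13OfThm1CCMWZBAx F 2 j γ a₀ ε₀ ε₂₉ B₃ B₃' a₀ a₁ (Efl j γ ε₀ ε₂₉ B₃ B₃' a₀ a₁) (fun p i => Real.log (B16ZLower.zNorm (SU 2) (gOfRecord₁₃Ax F 2 (theta13OfThm1CCMWZBAx F 2 j γ a₀ ε₀ ε₂₉ B₃ B₃' a₀ a₁ (fun _ _ => 0) (fun _ _ => 0)) p i ^ 2) ε))).toStage3Params lam8)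
    (h06F : ∀ {j : ℕ} {γ ε₀ ε₂₉ B₃ B₃' a₀ a₁ : ℝ} (hγ₀ : 0 < γ) (hγh : γ ≤ 1 / 2) (hε : 0 < ε₀) (hε' : 0 < ε₂₉) (hB : 0 ≤ B₃) (hB' : 0 ≤ B₃') (ha₀ : 0 < a₀) (ha₁ : 0 < a₁) (ha₀ρ : a₀ ≤ 1 / (109824 * (F.L : ℝ) ^ 2)) (hε₀ρ : ε₀ = a₀) {bl β' : ℝ} (hbox : BetaLowerH bl γ (betaOfRecord₁₃Ax F 2 (theta13OfThm1CCMWZBAx F 2 j γ a₀ ε₀ ε₂₉ B₃ B₃' a₀ a₁ (Efl j γ ε₀ ε₂₉ B₃ B₃' a₀ a₁) (fun p i => Real.log (B16ZLower.zNorm (SU 2) (gOfRecord₁₃Ax F 2 (theta13OfThm1CCMWZBAx F 2 j γ a₀ ε₀ ε₂₉ B₃ B₃' a₀ a₁ (fun _ _ => 0) (fun _ _ => 0)) p i ^ 2) ε))))) (hbox' : BetaUpperH β' γ (betaOfRecord₁₃Ax F 2 (theta13OfThm1CCMWZBAx F 2 j γ a₀ ε₀ ε₂₉ B₃ B₃'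 a₀ a₁ (Efl j γ ε₀ ε₂₉ B₃ B₃' a₀ a₁) (fun p i => Real.log (B16ZLower.zNorm (SU 2) (gOfRecord₁₃Ax F 2 (theta13OfThm1CCMWZBAx F 2 j γ a₀ ε₀ ε₂₉ B₃ B₃' a₀ a₁ (fun _ _ => 0) (fun _ _ => 0)) p i ^ 2) ε))))) (hl : -bl * γ ^ 2 ≤ 3) (hβ' : β' * γ ^ 2 ≤ 3 / 4),
      ∃ Y₀ : PrintedCarriers9X, B9LeafX Y₀)
    (h07 : ∃ ζ : ResidZ F 2, B11Leaf (Z11OfRecord F 2 ζ))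
    (h08 : PrintedUV3V 2 F.L)
    (h09F : ∀ {j : ℕ} {γ ε₀ ε₂₉ B₃ B₃' a₀ a₁ : ℝ} (hγ₀ : 0 < γ) (hγh : γ ≤ 1 / 2) (hε : 0 < ε₀) (hε' : 0 < ε₂₉) (hB : 0 ≤ B₃) (hB' : 0 ≤ B₃') (ha₀ : 0 < a₀) (ha₁ : 0 < a₁) (ha₀ρ : a₀ ≤ 1 / (109824 * (F.L : ℝ) ^ 2)) (hε₀ρ : ε₀ = a₀) {bl β' : ℝ} (hbox : BetaLowerH bl γ (betaOfRecord₁₃Ax F 2 (theta13OfThm1CCMWZBAx F 2 j γ a₀ ε₀ ε₂₉ B₃ B₃' a₀ a₁ (Efl j γ ε₀ ε₂₉ B₃ B₃' a₀ a₁) (fun p i => Real.log (B16ZLower.zNorm (SU 2) (gOfRecord₁₃Ax F 2 (theta13OfThm1CCMWZBAx F 2 j γ a₀ ε₀ ε₂₉ B₃ B₃' a₀ a₁ (fun _ _ => 0) (fun _ _ => 0)) p i ^ 2) ε))))) (hbox' : BetaUpperH β' γ (betaOfRecord₁₃Ax F 2 (theta13OfThm1CCMWZBAx F 2 j γ a₀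 ε₀ ε₂₉ B₃ B₃' a₀ a₁ (Efl j γ ε₀ ε₂₉ B₃ B₃' a₀ a₁) (fun p i => Real.log (B16ZLower.zNorm (SU 2) (gOfRecord₁₃Ax F 2 (theta13OfThm1CCMWZBAx F 2 j γ a₀ ε₀ ε₂₉ B₃ B₃' a₀ a₁ (fun _ _ => 0) (fun _ _ => 0)) p i ^ 2) ε))))) (hl : -bl * γ ^ 2 ≤ 3) (hβ' : β' * γ ^ 2 ≤ 3 / 4),
      ∃ lam12 : ResidB12 F 2 (theta13OfThm1CCMWZBAx F 2 j γ a₀ ε₀ ε₂₉ B₃ B₃' a₀ a₁ (Efl j γ ε₀ ε₂₉ B₃ B₃' a₀ a₁) (fun p i => Real.log (B16ZLower.zNorm (SU 2) (gOfRecord₁₃Ax F 2 (theta13OfThm1CCMWZBAx F 2 j γ a₀ ε₀ ε₂₉ B₃ B₃' a₀ a₁ (fun _ _ => 0) (fun _ _ => 0)) p i ^ 2) ε))).τ9.M,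
      ∀ P : B12.RunParams, B12Sec2to5.Lemma4Printed (F12OfRecord₁₂ F 2 (theta13OfThm1CCMWZBAx F 2 j γ a₀ ε₀ ε₂₉ B₃ B₃' a₀ a₁ (Efl j γ ε₀ ε₂₉ B₃ B₃' a₀ a₁) (fun p i => Real.log (B16ZLower.zNorm (SU 2) (gOfRecord₁₃Ax F 2 (theta13OfThm1CCMWZBAx F 2 j γ a₀ ε₀ ε₂₉ B₃ B₃' a₀ a₁ (fun _ _ => 0) (fun _ _ => 0)) p i ^ 2) ε))).toStage12Params lam12 P) (lam12 P).consts)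
    (h09RF : ∀ {j : ℕ} {γ ε₀ ε₂₉ B₃ B₃' a₀ a₁ : ℝ} (hγ₀ : 0 < γ) (hγh : γ ≤ 1 / 2) (hε : 0 < ε₀) (hε' : 0 < ε₂₉) (hB : 0 ≤ B₃) (hB' : 0 ≤ B₃') (ha₀ : 0 < a₀) (ha₁ : 0 < a₁) (ha₀ρ : a₀ ≤ 1 / (109824 * (F.L : ℝ) ^ 2)) (hε₀ρ : ε₀ = a₀) {bl β' : ℝ} (hbox : BetaLowerH bl γ (betaOfRecord₁₃Ax F 2 (theta13OfThm1CCMWZBAx F 2 j γ a₀ ε₀ ε₂₉ B₃ B₃' a₀ a₁ (Efl j γ ε₀ ε₂₉ B₃ B₃' a₀ a₁) (fun p i => Real.log (B16ZLower.zNorm (SU 2) (gOfRecord₁₃Ax F 2 (theta13OfThm1CCMWZBAx F 2 j γ a₀ ε₀ ε₂₉ B₃ B₃' a₀ a₁ (fun _ _ => 0) (fun _ _ => 0)) p i ^ 2) ε))))) (hbox' : BetaUpperH β' γ (betaOfRecord₁₃Ax F 2 (theta13OfThm1CCMWZBAx F 2 j γ a₀ ε₀ ε₂₉ B₃ B₃'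 a₀ a₁ (Efl j γ ε₀ ε₂₉ B₃ B₃' a₀ a₁) (fun p i => Real.log (B16ZLower.zNorm (SU 2) (gOfRecord₁₃Ax F 2 (theta13OfThm1CCMWZBAx F 2 j γ a₀ ε₀ ε₂₉ B₃ B₃' a₀ a₁ (fun _ _ => 0) (fun _ _ => 0)) p i ^ 2) ε))))) (hl : -bl * γ ^ 2 ≤ 3) (hβ' : β' * γ ^ 2 ≤ 3 / 4)
      (hP : (gaussPinH (Stage13HParams.ofHistoryBlind F 2 ⟨theta13OfThm1CCMWZBAx F 2 j γ a₀ ε₀ ε₂₉ B₃ B₃' a₀ a₁ (Efl j γ ε₀ ε₂₉ B₃ B₃' a₀ a₁) (fun p i => Real.log (B16ZLower.zNorm (SU 2) (gOfRecord₁₃Ax F 2 (theta13OfThm1CCMWZBAx F 2 j γ a₀ ε₀ ε₂₉ B₃ B₃' a₀ a₁ (fun _ _ => 0) (fun _ _ => 0)) p i ^ 2) ε)), ZrOfRecord₁₃Ax F 2 (theta13OfThm1CCMWZBAx F 2 j γ a₀ ε₀ ε₂₉ B₃ B₃' a₀ a₁ (Efl j γ ε₀ ε₂₉ B₃ B₃'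 a₀ a₁) (fun p i => Real.log (B16ZLower.zNorm (SU 2) (gOfRecord₁₃Ax F 2 (theta13OfThm1CCMWZBAx F 2 j γ a₀ ε₀ ε₂₉ B₃ B₃' a₀ a₁ (fun _ _ => 0) (fun _ _ => 0)) p i ^ 2) ε)))⟩) (chiFixed29Ax F 2 (numerics7OfThm1CCM F.L j ε₀ B₃ B₃' a₀ a₁) ε₂₉)).Provisos₁₃SepCoPHAx F 2),
      ∀ (θN : Stage13HParams F 2), θN = (gaussPinH (Stage13HParams.ofHistoryBlind F 2 ⟨theta13OfThm1CCMWZBAx F 2 j γ a₀ ε₀ ε₂₉ B₃ B₃' a₀ a₁ (Efl j γ ε₀ ε₂₉ B₃ B₃' a₀ a₁) (fun p i => Real.log (B16ZLower.zNorm (SU 2) (gOfRecord₁₃Ax F 2 (theta13OfThm1CCMWZBAx F 2 j γ a₀ ε₀ ε₂₉ B₃ B₃' a₀ a₁ (fun _ _ => 0) (fun _ _ => 0)) p i ^ 2) ε)), ZrOfRecord₁₃Ax F 2 (theta13OfThm1CCMWZBAx F 2 j γ a₀ ε₀ ε₂₉ B₃ B₃' a₀ a₁ (Efl j γ ε₀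 ε₂₉ B₃ B₃' a₀ a₁) (fun p i => Real.log (B16ZLower.zNorm (SU 2) (gOfRecord₁₃Ax F 2 (theta13OfThm1CCMWZBAx F 2 j γ a₀ ε₀ ε₂₉ B₃ B₃' a₀ a₁ (fun _ _ => 0) (fun _ _ => 0)) p i ^ 2) ε)))⟩) (chiFixed29Ax F 2 (numerics7OfThm1CCM F.L j ε₀ B₃ B₃' a₀ a₁) ε₂₉)) →
      (∀ (P : B12.RunParams) (k : ℕ), k ≤ P.K → ∀ V ∈ domAltOfRecord F 2 θN.ν P.K k, Uk F 2 P.K k θN.εbg V ∈ bgReg F 2 P.K k θN.ν.εreg) ∧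
        (θN.ν.εreg ≤ θN.εbg) ∧
        (0 ≤ θN.ν.εreg) ∧
        (∀ (P : B12.RunParams) (k : ℕ), k ≤ P.K → ∀ V ∈ domAltOfRecord F 2 θN.ν P.K k, ∀ j < k,
      AxialGauge (contourOfRecord F 2 P.K j) (Averaging.iter (avOfRecord F 2 P.K) j (Uk F 2 P.K k θN.εbg V))) ∧
        (∀ (P : B12.RunParams) (i : ℕ), i + 1 < P.K → ∀ U : GaugeField (F.P P.K) (i + 1) (SU 2),
      (avOfRecord F 2 P.K (i + 1)).avg U ∈ domAltOfRecord F 2 θN.ν P.K (i + 2) →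
        U ∉ regSetOfRecord F 2 P.K i (betaInputOfRecord F 2 (TβOfRecord₁₃ F 2) (chiβOfRecord₁₃Ax F 2 θN.toStage13Params) P.K (gOfRecord₁₃Ax F 2 θN.toStage13Params P) i) ∩
            domAltOfRecord F 2 θN.ν P.K (i + 1) →
          chiβOfRecord₁₃Ax F 2 θN.toStage13Params P.K (gOfRecord₁₃Ax F 2 θN.toStage13Params P) (i + 1) U = 0) ∧
        (∀ (P : B12.RunParams), ∀ j < P.K, Integrable (betaInputOfRecord F 2 (TβOfRecord₁₃ F 2) (chiβOfRecord₁₃Ax F 2 θN.toStage13Params) P.K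
      (gOfRecord₁₃Ax F 2 θN.toStage13Params P) j) (fieldMeasure (F.P P.K) j (SU 2))) ∧
        (∀ (P : B12.RunParams) (k : ℕ), k ≤ P.K → ∀ V ∈ domAltOfRecord F 2 θN.ν P.K k, UkExists F 2 P.K k θN.εbg V ∧ UniqueUkOrbit F 2 P.K k θN.εbg V) ∧
        (∀ (P : B12.RunParams) (k : ℕ), k ≤ P.K → HRestrict F 2 θN.εbg P.K k (domAltOfRecord F 2 θN.ν P.K k)) ∧
        (∀ (P : B12.RunParams) (k : ℕ), k ≤ P.K → ∀ V ∈ domAltOfRecord F 2 θN.ν P.K k, ∀ j < k,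
      UniqueUkOrbit F 2 P.K (j + 1) θN.εbg (Averaging.iter (avOfRecord F 2 P.K) (j + 1) (Uk F 2 P.K k θN.εbg V))) ∧
        (0 < θN.ε₂₉) ∧
        (0 < θN.εbg) ∧
        (∀ P : B12.RunParams, (143 * (((((F.P P.K).d + 4 : ℕ) : ℝ)) ^ 2 / 4) ^ 2) * θN.εbg ≤ 1 / 3) ∧
        (∀ P : B12.RunParams, 2 * θN.εbg ≤ 2 * deltaSU (Fin 2) / ((((F.P P.K).d + 4) * (F.P P.K).L : ℕ) : ℝ) ^ 2) ∧
        (∀ P : B12.RunParams, 2 * θN.εbg ≤ θN.ν.ε₀ * ((F.P P.K).L : ℝ) ^ 2))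
    (h10F : ∀ {j : ℕ} {γ ε₀ ε₂₉ B₃ B₃' a₀ a₁ : ℝ} (hγ₀ : 0 < γ) (hγh : γ ≤ 1 / 2) (hε : 0 < ε₀) (hε' : 0 < ε₂₉) (hB : 0 ≤ B₃) (hB' : 0 ≤ B₃') (ha₀ : 0 < a₀) (ha₁ : 0 < a₁) (ha₀ρ : a₀ ≤ 1 / (109824 * (F.L : ℝ) ^ 2)) (hε₀ρ : ε₀ = a₀) {bl β' : ℝ} (hbox : BetaLowerH bl γ (betaOfRecord₁₃Ax F 2 (theta13OfThm1CCMWZBAx F 2 j γ a₀ ε₀ ε₂₉ B₃ B₃' a₀ a₁ (Efl j γ ε₀ ε₂₉ B₃ B₃' a₀ a₁) (fun p i => Real.log (B16ZLower.zNorm (SU 2) (gOfRecord₁₃Ax F 2 (theta13OfThm1CCMWZBAx F 2 j γ a₀ ε₀ ε₂₉ B₃ B₃' a₀ a₁ (fun _ _ => 0) (fun _ _ => 0)) p i ^ 2) ε))))) (hbox' : BetaUpperH β' γ (betaOfRecord₁₃Ax F 2 (theta13OfThm1CCMWZBAx F 2 j γ a₀ ε₀ ε₂₉ B₃ B₃'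 a₀ a₁ (Efl j γ ε₀ ε₂₉ B₃ B₃' a₀ a₁) (fun p i => Real.log (B16ZLower.zNorm (SU 2) (gOfRecord₁₃Ax F 2 (theta13OfThm1CCMWZBAx F 2 j γ a₀ ε₀ ε₂₉ B₃ B₃' a₀ a₁ (fun _ _ => 0) (fun _ _ => 0)) p i ^ 2) ε))))) (hl : -bl * γ ^ 2 ≤ 3) (hβ' : β' * γ ^ 2 ≤ 3 / 4),
      ∃ lam13 : B12.RunParams → ResidB13 (theta13OfThm1CCMWZBAx F 2 j γ a₀ ε₀ ε₂₉ B₃ B₃' a₀ a₁ (Efl j γ ε₀ ε₂₉ B₃ B₃' a₀ a₁) (fun p i => Real.log (B16ZLower.zNorm (SU 2) (gOfRecord₁₃Ax F 2 (theta13OfThm1CCMWZBAx F 2 j γ a₀ ε₀ ε₂₉ B₃ B₃' a₀ a₁ (fun _ _ => 0) (fun _ _ => 0)) p i ^ 2) ε))).toStage3Params,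
      ∀ P : B12.RunParams, B13LeafOfRecord (theta13OfThm1CCMWZBAx F 2 j γ a₀ ε₀ ε₂₉ B₃ B₃' a₀ a₁ (Efl j γ ε₀ ε₂₉ B₃ B₃' a₀ a₁) (fun p i => Real.log (B16ZLower.zNorm (SU 2) (gOfRecord₁₃Ax F 2 (theta13OfThm1CCMWZBAx F 2 j γ a₀ ε₀ ε₂₉ B₃ B₃' a₀ a₁ (fun _ _ => 0) (fun _ _ => 0)) p i ^ 2) ε))).toStage3Params (lam13 P))
    (h11N : ∀ {j : ℕ} {γ ε₀ ε₂₉ B₃ B₃' a₀ a₁ : ℝ} (hγ₀ : 0 < γ) (hγh : γ ≤ 1 / 2) (hε : 0 < ε₀) (hε' : 0 < ε₂₉) (hB : 0 ≤ B₃) (hB' : 0 ≤ B₃') (ha₀ : 0 < a₀) (ha₁ : 0 < a₁) (ha₀ρ : a₀ ≤ 1 / (109824 * (F.L : ℝ) ^ 2)) (hε₀ρ : ε₀ = a₀) {bl β' : ℝ} (hbox : BetaLowerH bl γ (betaOfRecord₁₃Ax F 2 (theta13OfThm1CCMWZBAx F 2 j γ a₀ ε₀ ε₂₉ B₃ B₃'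 a₀ a₁ (Efl j γ ε₀ ε₂₉ B₃ B₃' a₀ a₁) (fun p i => Real.log (B16ZLower.zNorm (SU 2) (gOfRecord₁₃Ax F 2 (theta13OfThm1CCMWZBAx F 2 j γ a₀ ε₀ ε₂₉ B₃ B₃' a₀ a₁ (fun _ _ => 0) (fun _ _ => 0)) p i ^ 2) ε))))) (hbox' : BetaUpperH β' γ (betaOfRecord₁₃Ax F 2 (theta13OfThm1CCMWZBAx F 2 j γ a₀ ε₀ ε₂₉ B₃ B₃' a₀ a₁ (Efl j γ ε₀ ε₂₉ B₃ B₃' a₀ a₁) (fun p i => Real.log (B16ZLower.zNorm (SU 2) (gOfRecord₁₃Ax F 2 (theta13OfThm1CCMWZBAx F 2 j γ a₀ ε₀ ε₂₉ B₃ B₃' a₀ a₁ (fun _ _ => 0) (fun _ _ => 0)) p i ^ 2) ε))))) (hl : -bl * γ ^ 2 ≤ 3) (hβ' : β' * γ ^ 2 ≤ 3 / 4),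
      ∃ σ : (P : B12.RunParams) → Sect3Supplier (gaussPinH (Stage13HParams.ofHistoryBlind F 2 ⟨theta13OfThm1CCMWZBAx F 2 j γ a₀ ε₀ ε₂₉ B₃ B₃' a₀ a₁ (Efl j γ ε₀ ε₂₉ B₃ B₃' a₀ a₁) (fun p i => Real.log (B16ZLower.zNorm (SU 2) (gOfRecord₁₃Ax F 2 (theta13OfThm1CCMWZBAx F 2 j γ a₀ ε₀ ε₂₉ B₃ B₃' a₀ a₁ (fun _ _ => 0) (fun _ _ => 0)) p i ^ 2) ε)), ZrOfRecord₁₃Ax F 2 (theta13OfThm1CCMWZBAx F 2 j γ a₀ ε₀ ε₂₉ B₃ B₃' a₀ a₁ (Efl j γ ε₀ ε₂₉ B₃ B₃' a₀ a₁) (fun p i => Real.log (B16ZLower.zNorm (SU 2) (gOfRecord₁₃Ax F 2 (theta13OfThm1CCMWZBAx F 2 j γ a₀ ε₀ ε₂₉ B₃ B₃' a₀ a₁ (fun _ _ => 0) (fun _ _ => 0)) p i ^ 2) ε)))⟩) (chiFixed29Ax F 2 (numerics7OfThm1CCM F.L j ε₀ B₃ B₃' a₀ a₁) ε₂₉)) (chiFixed29Ax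 F 2 (numerics7OfThm1CCM F.L j ε₀ B₃ B₃' a₀ a₁) ε₂₉) P,
        (∀ P : B12.RunParams, Step.InInterval γ P.K (gOfRecord₁₃Ax F 2 (theta13OfThm1CCMWZBAx F 2 j γ a₀ ε₀ ε₂₉ B₃ B₃' a₀ a₁ (Efl j γ ε₀ ε₂₉ B₃ B₃' a₀ a₁) (fun p i => Real.log (B16ZLower.zNorm (SU 2) (gOfRecord₁₃Ax F 2 (theta13OfThm1CCMWZBAx F 2 j γ a₀ ε₀ ε₂₉ B₃ B₃' a₀ a₁ (fun _ _ => 0) (fun _ _ => 0)) p i ^ 2) ε))) P) → SupplierObligations (gaussPinH (Stage13HParams.ofHistoryBlind F 2 ⟨theta13OfThm1CCMWZBAx F 2 j γ a₀ ε₀ ε₂₉ B₃ B₃' a₀ a₁ (Efl j γ ε₀ ε₂₉ B₃ B₃' a₀ a₁) (fun p i => Real.log (B16ZLower.zNorm (SU 2) (gOfRecord₁₃Ax F 2 (theta13OfThm1CCMWZBAx F 2 j γ a₀ ε₀ ε₂₉ B₃ B₃' a₀ a₁ (fun _ _ => 0) (fun _ _ => 0)) p i ^ 2) ε)), ZrOfRecord₁₃Ax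 F 2 (theta13OfThm1CCMWZBAx F 2 j γ a₀ ε₀ ε₂₉ B₃ B₃' a₀ a₁ (Efl j γ ε₀ ε₂₉ B₃ B₃' a₀ a₁) (fun p i => Real.log (B16ZLower.zNorm (SU 2) (gOfRecord₁₃Ax F 2 (theta13OfThm1CCMWZBAx F 2 j γ a₀ ε₀ ε₂₉ B₃ B₃' a₀ a₁ (fun _ _ => 0) (fun _ _ => 0)) p i ^ 2) ε)))⟩) (chiFixed29Ax F 2 (numerics7OfThm1CCM F.L j ε₀ B₃ B₃' a₀ a₁) ε₂₉)) (chiFixed29Ax F 2 (numerics7OfThm1CCM F.L j ε₀ B₃ B₃' a₀ a₁) ε₂₉) P (σ P)) ∧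
        (∀ P : B12.RunParams, Step.InInterval γ P.K (gOfRecord₁₃Ax F 2 (theta13OfThm1CCMWZBAx F 2 j γ a₀ ε₀ ε₂₉ B₃ B₃' a₀ a₁ (Efl j γ ε₀ ε₂₉ B₃ B₃' a₀ a₁) (fun p i => Real.log (B16ZLower.zNorm (SU 2) (gOfRecord₁₃Ax F 2 (theta13OfThm1CCMWZBAx F 2 j γ a₀ ε₀ ε₂₉ B₃ B₃' a₀ a₁ (fun _ _ => 0) (fun _ _ => 0)) p i ^ 2) ε))) P) → OperandRowsAlongChain (gaussPinH (Stage13HParams.ofHistoryBlind F 2 ⟨theta13OfThm1CCMWZBAx F 2 j γ a₀ ε₀ ε₂₉ B₃ B₃' a₀ a₁ (Efl j γ ε₀ ε₂₉ B₃ B₃' a₀ a₁) (fun p i => Real.log (B16ZLower.zNorm (SU 2) (gOfRecord₁₃Ax F 2 (theta13OfThm1CCMWZBAx F 2 j γ a₀ ε₀ ε₂₉ B₃ B₃' a₀ a₁ (fun _ _ => 0) (fun _ _ => 0)) p i ^ 2) ε)), ZrOfRecord₁₃Ax F 2 (theta13OfThm1CCMWZBAx F 2 j γ a₀ ε₀ ε₂₉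 B₃ B₃' a₀ a₁ (Efl j γ ε₀ ε₂₉ B₃ B₃' a₀ a₁) (fun p i => Real.log (B16ZLower.zNorm (SU 2) (gOfRecord₁₃Ax F 2 (theta13OfThm1CCMWZBAx F 2 j γ a₀ ε₀ ε₂₉ B₃ B₃' a₀ a₁ (fun _ _ => 0) (fun _ _ => 0)) p i ^ 2) ε)))⟩) (chiFixed29Ax F 2 (numerics7OfThm1CCM F.L j ε₀ B₃ B₃' a₀ a₁) ε₂₉)) (chiFixed29Ax F 2 (numerics7OfThm1CCM F.L j ε₀ B₃ B₃' a₀ a₁) ε₂₉) P (σ P)))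
    (h12F : ∀ {j : ℕ} {γ ε₀ ε₂₉ B₃ B₃' a₀ a₁ : ℝ} (hγ₀ : 0 < γ) (hγh : γ ≤ 1 / 2) (hε : 0 < ε₀) (hε' : 0 < ε₂₉) (hB : 0 ≤ B₃) (hB' : 0 ≤ B₃') (ha₀ : 0 < a₀) (ha₁ : 0 < a₁) (ha₀ρ : a₀ ≤ 1 / (109824 * (F.L : ℝ) ^ 2)) (hε₀ρ : ε₀ = a₀) {bl β' : ℝ} (hbox : BetaLowerH bl γ (betaOfRecord₁₃Ax F 2 (theta13OfThm1CCMWZBAx F 2 j γ a₀ ε₀ ε₂₉ B₃ B₃' a₀ a₁ (Efl j γ ε₀ ε₂₉ B₃ B₃' a₀ a₁) (fun p i => Real.log (B16ZLower.zNorm (SU 2) (gOfRecord₁₃Ax F 2 (theta13OfThm1CCMWZBAx F 2 j γ a₀ ε₀ ε₂₉ B₃ B₃' a₀ a₁ (fun _ _ => 0) (fun _ _ => 0)) p i ^ 2) ε))))) (hbox' : BetaUpperH β' γ (betaOfRecord₁₃Ax F 2 (theta13OfThm1CCMWZBAx F 2 j γ a₀ ε₀ ε₂₉ B₃ B₃'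 a₀ a₁ (Efl j γ ε₀ ε₂₉ B₃ B₃' a₀ a₁) (fun p i => Real.log (B16ZLower.zNorm (SU 2) (gOfRecord₁₃Ax F 2 (theta13OfThm1CCMWZBAx F 2 j γ a₀ ε₀ ε₂₉ B₃ B₃' a₀ a₁ (fun _ _ => 0) (fun _ _ => 0)) p i ^ 2) ε))))) (hl : -bl * γ ^ 2 ≤ 3) (hβ' : β' * γ ^ 2 ≤ 3 / 4)
      (hP : (gaussPinH (Stage13HParams.ofHistoryBlind F 2 ⟨theta13OfThm1CCMWZBAx F 2 j γ a₀ ε₀ ε₂₉ B₃ B₃' a₀ a₁ (Efl j γ ε₀ ε₂₉ B₃ B₃' a₀ a₁) (fun p i => Real.log (B16ZLower.zNorm (SU 2) (gOfRecord₁₃Ax F 2 (theta13OfThm1CCMWZBAx F 2 j γ a₀ ε₀ ε₂₉ B₃ B₃' a₀ a₁ (fun _ _ => 0) (fun _ _ => 0)) p i ^ 2) ε)), ZrOfRecord₁₃Ax F 2 (theta13OfThm1CCMWZBAx F 2 j γ a₀ ε₀ ε₂₉ B₃ B₃' a₀ a₁ (Efl j γ ε₀ ε₂₉ B₃ B₃'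 a₀ a₁) (fun p i => Real.log (B16ZLower.zNorm (SU 2) (gOfRecord₁₃Ax F 2 (theta13OfThm1CCMWZBAx F 2 j γ a₀ ε₀ ε₂₉ B₃ B₃' a₀ a₁ (fun _ _ => 0) (fun _ _ => 0)) p i ^ 2) ε)))⟩) (chiFixed29Ax F 2 (numerics7OfThm1CCM F.L j ε₀ B₃ B₃' a₀ a₁) ε₂₉)).Provisos₁₃SepCoPHAx F 2),
      ∃ (lamW : ResidW F 2) (γ₁₂ : ℝ), 0 < γ₁₂ ∧ (∀ P : B12.RunParams, 1 ≤ P.K → lamW.kSel P < P.K) ∧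
        ∀ P : B12.RunParams, lamW.kSel P < P.K → Step.InInterval γ₁₂ P.K (gOfRecord₁₃Ax F 2 (gaussPinH (Stage13HParams.ofHistoryBlind F 2 ⟨theta13OfThm1CCMWZBAx F 2 j γ a₀ ε₀ ε₂₉ B₃ B₃' a₀ a₁ (Efl j γ ε₀ ε₂₉ B₃ B₃' a₀ a₁) (fun p i => Real.log (B16ZLower.zNorm (SU 2) (gOfRecord₁₃Ax F 2 (theta13OfThm1CCMWZBAx F 2 j γ a₀ ε₀ ε₂₉ B₃ B₃' a₀ a₁ (fun _ _ => 0) (fun _ _ => 0)) p i ^ 2) ε)), ZrOfRecord₁₃Ax F 2 (theta13OfThm1CCMWZBAx F 2 j γ a₀ ε₀ ε₂₉ B₃ B₃' a₀ a₁ (Efl j γ ε₀ ε₂₉ B₃ B₃' a₀ a₁) (fun p i => Real.log (B16ZLower.zNorm (SU 2) (gOfRecord₁₃Ax F 2 (theta13OfThm1CCMWZBAx F 2 j γ a₀ ε₀ ε₂₉ B₃ B₃' a₀ a₁ (fun _ _ => 0) (fun _ _ => 0)) p i ^ 2) ε)))⟩) (chiFixed29Ax F 2 (numerics7OfThm1CCM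 F.L j ε₀ B₃ B₃' a₀ a₁) ε₂₉)).toStage13Params P) →
          B15Leaf (WOfRecord₁₃Ax F 2 (gaussPinH (Stage13HParams.ofHistoryBlind F 2 ⟨theta13OfThm1CCMWZBAx F 2 j γ a₀ ε₀ ε₂₉ B₃ B₃' a₀ a₁ (Efl j γ ε₀ ε₂₉ B₃ B₃' a₀ a₁) (fun p i => Real.log (B16ZLower.zNorm (SU 2) (gOfRecord₁₃Ax F 2 (theta13OfThm1CCMWZBAx F 2 j γ a₀ ε₀ ε₂₉ B₃ B₃' a₀ a₁ (fun _ _ => 0) (fun _ _ => 0)) p i ^ 2) ε)), ZrOfRecord₁₃Ax F 2 (theta13OfThm1CCMWZBAx F 2 j γ a₀ ε₀ ε₂₉ B₃ B₃' a₀ a₁ (Efl j γ ε₀ ε₂₉ B₃ B₃' a₀ a₁) (fun p i => Real.log (B16ZLower.zNorm (SU 2) (gOfRecord₁₃Ax F 2 (theta13OfThm1CCMWZBAx F 2 j γ a₀ ε₀ ε₂₉ B₃ B₃' a₀ a₁ (fun _ _ => 0) (fun _ _ => 0)) p i ^ 2) ε)))⟩) (chiFixed29Ax F 2 (numerics7OfThm1CCM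 F.L j ε₀ B₃ B₃' a₀ a₁) ε₂₉)).toStage13Params lamW P))
    (hEfl : ∀ (j : ℕ) (γ ε₀ ε₂₉ B₃ B₃' a₀ a₁ : ℝ), ∃ CE : ℝ, 0 ≤ CE ∧ ∀ (P : B12.RunParams) (i : ℕ), i < P.K → |Efl j γ ε₀ ε₂₉ B₃ B₃' a₀ a₁ P i| ≤ CE * sitesCard (F.P P.K) (i + 1))
    (h13posF : ∀ {j : ℕ} {γ ε₀ ε₂₉ B₃ B₃' a₀ a₁ : ℝ} (hγ₀ : 0 < γ) (hγh : γ ≤ 1 / 2) (hε : 0 < ε₀) (hε' : 0 < ε₂₉) (hB : 0 ≤ B₃) (hB' : 0 ≤ B₃') (ha₀ : 0 < a₀) (ha₁ : 0 < a₁) (ha₀ρ : a₀ ≤ 1 / (109824 * (F.L : ℝ) ^ 2)) (hε₀ρ : ε₀ = a₀) {bl β' : ℝ} (hbox : BetaLowerH bl γ (betaOfRecord₁₃Ax F 2 (theta13OfThm1CCMWZBAx F 2 j γ a₀ ε₀ ε₂₉ B₃ B₃' a₀ a₁ (Efl j γ ε₀ ε₂₉ B₃ B₃' a₀ a₁) (fun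 p i => Real.log (B16ZLower.zNorm (SU 2) (gOfRecord₁₃Ax F 2 (theta13OfThm1CCMWZBAx F 2 j γ a₀ ε₀ ε₂₉ B₃ B₃' a₀ a₁ (fun _ _ => 0) (fun _ _ => 0)) p i ^ 2) ε))))) (hbox' : BetaUpperH β' γ (betaOfRecord₁₃Ax F 2 (theta13OfThm1CCMWZBAx F 2 j γ a₀ ε₀ ε₂₉ B₃ B₃' a₀ a₁ (Efl j γ ε₀ ε₂₉ B₃ B₃' a₀ a₁) (fun p i => Real.log (B16ZLower.zNorm (SU 2) (gOfRecord₁₃Ax F 2 (theta13OfThm1CCMWZBAx F 2 j γ a₀ ε₀ ε₂₉ B₃ B₃' a₀ a₁ (fun _ _ => 0) (fun _ _ => 0)) p i ^ 2) ε))))) (hl : -bl * γ ^ 2 ≤ 3) (hβ' : β' * γ ^ 2 ≤ 3 / 4)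
      (hP : (gaussPinH (Stage13HParams.ofHistoryBlind F 2 ⟨theta13OfThm1CCMWZBAx F 2 j γ a₀ ε₀ ε₂₉ B₃ B₃' a₀ a₁ (Efl j γ ε₀ ε₂₉ B₃ B₃' a₀ a₁) (fun p i => Real.log (B16ZLower.zNorm (SU 2) (gOfRecord₁₃Ax F 2 (theta13OfThm1CCMWZBAx F 2 j γ a₀ ε₀ ε₂₉ B₃ B₃' a₀ a₁ (fun _ _ => 0) (fun _ _ => 0)) p i ^ 2) ε)), ZrOfRecord₁₃Ax F 2 (theta13OfThm1CCMWZBAx F 2 j γ a₀ ε₀ ε₂₉ B₃ B₃' a₀ a₁ (Efl j γ ε₀ ε₂₉ B₃ B₃' a₀ a₁) (fun p i => Real.log (B16ZLower.zNorm (SU 2) (gOfRecord₁₃Ax F 2 (theta13OfThm1CCMWZBAx F 2 j γ a₀ ε₀ ε₂₉ B₃ B₃' a₀ a₁ (fun _ _ => 0) (fun _ _ => 0)) p i ^ 2) ε)))⟩) (chiFixed29Ax F 2 (numerics7OfThm1CCM F.L j ε₀ B₃ B₃' a₀ a₁) ε₂₉)).Provisos₁₃SepCoPHAx F 2),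
      ∃ γ₁₃ : ℝ, 0 < γ₁₃ ∧ ∃ em ep : ℝ → ℝ,
        (∀ P : B12.RunParams, ((datumOfRecord₁₃SepCoPHAx F 2 (gaussPinH (Stage13HParams.ofHistoryBlind F 2 ⟨theta13OfThm1CCMWZBAx F 2 j γ a₀ ε₀ ε₂₉ B₃ B₃' a₀ a₁ (Efl j γ ε₀ ε₂₉ B₃ B₃' a₀ a₁) (fun p i => Real.log (B16ZLower.zNorm (SU 2) (gOfRecord₁₃Ax F 2 (theta13OfThm1CCMWZBAx F 2 j γ a₀ ε₀ ε₂₉ B₃ B₃' a₀ a₁ (fun _ _ => 0) (fun _ _ => 0)) p i ^ 2) ε)), ZrOfRecord₁₃Ax F 2 (theta13OfThm1CCMWZBAx F 2 j γ a₀ ε₀ ε₂₉ B₃ B₃' a₀ a₁ (Efl j γ ε₀ ε₂₉ B₃ B₃' a₀ a₁) (fun p i => Real.log (B16ZLower.zNorm (SU 2) (gOfRecord₁₃Ax F 2 (theta13OfThm1CCMWZBAx F 2 j γ a₀ ε₀ ε₂₉ B₃ B₃' a₀ a₁ (fun _ _ => 0) (fun _ _ => 0)) p i ^ 2) ε)))⟩)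 (chiFixed29Ax F 2 (numerics7OfThm1CCM F.L j ε₀ B₃ B₃' a₀ a₁) ε₂₉)) hP).C P).flow.InInterval γ₁₃ P.K → ∀ k, k + 1 ≤ P.K → SLaw₁₃CoPHChi F 2 (gaussPinH (Stage13HParams.ofHistoryBlind F 2 ⟨theta13OfThm1CCMWZBAx F 2 j γ a₀ ε₀ ε₂₉ B₃ B₃' a₀ a₁ (Efl j γ ε₀ ε₂₉ B₃ B₃' a₀ a₁) (fun p i => Real.log (B16ZLower.zNorm (SU 2) (gOfRecord₁₃Ax F 2 (theta13OfThm1CCMWZBAx F 2 j γ a₀ ε₀ ε₂₉ B₃ B₃' a₀ a₁ (fun _ _ => 0) (fun _ _ => 0)) p i ^ 2) ε)), ZrOfRecord₁₃Ax F 2 (theta13OfThm1CCMWZBAx F 2 j γ a₀ ε₀ ε₂₉ B₃ B₃' a₀ a₁ (Efl j γ ε₀ ε₂₉ B₃ B₃' a₀ a₁) (fun p i => Real.log (B16ZLower.zNorm (SU 2) (gOfRecord₁₃Ax F 2 (theta13OfThm1CCMWZBAx F 2 j γ a₀ ε₀ ε₂₉ B₃ B₃' a₀ a₁ (fun _ _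 => 0) (fun _ _ => 0)) p i ^ 2) ε)))⟩) (chiFixed29Ax F 2 (numerics7OfThm1CCM F.L j ε₀ B₃ B₃' a₀ a₁) ε₂₉)) (chiFixed29Ax F 2 (numerics7OfThm1CCM F.L j ε₀ B₃ B₃' a₀ a₁) ε₂₉) P (k + 1) →
      ∀ᵐ U ∂(fieldMeasure (F.P P.K) (k + 1) (SU 2)),
        chiβOfRecord₁₃Ax F 2 (theta13OfThm1CCMWZBAx F 2 j γ a₀ ε₀ ε₂₉ B₃ B₃' a₀ a₁ (Efl j γ ε₀ ε₂₉ B₃ B₃' a₀ a₁) (fun p i => Real.log (B16ZLower.zNorm (SU 2) (gOfRecord₁₃Ax F 2 (theta13OfThm1CCMWZBAx F 2 j γ a₀ ε₀ ε₂₉ B₃ B₃' a₀ a₁ (fun _ _ => 0) (fun _ _ => 0)) p i ^ 2) ε))) P.K (gOfRecord₁₃Ax F 2 (theta13OfThm1CCMWZBAx F 2 j γ a₀ ε₀ ε₂₉ B₃ B₃' a₀ a₁ (Efl j γ ε₀ ε₂₉ B₃ B₃' a₀ a₁) (fun p i => Real.log (B16ZLower.zNorm (SU 2) (gOfRecord₁₃Ax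 F 2 (theta13OfThm1CCMWZBAx F 2 j γ a₀ ε₀ ε₂₉ B₃ B₃' a₀ a₁ (fun _ _ => 0) (fun _ _ => 0)) p i ^ 2) ε))) P) (k + 1) U *
              Real.exp (-(1 / (gOfRecord₁₃Ax F 2 (theta13OfThm1CCMWZBAx F 2 j γ a₀ ε₀ ε₂₉ B₃ B₃' a₀ a₁ (Efl j γ ε₀ ε₂₉ B₃ B₃' a₀ a₁) (fun p i => Real.log (B16ZLower.zNorm (SU 2) (gOfRecord₁₃Ax F 2 (theta13OfThm1CCMWZBAx F 2 j γ a₀ ε₀ ε₂₉ B₃ B₃' a₀ a₁ (fun _ _ => 0) (fun _ _ => 0)) p i ^ 2) ε))) P (k + 1)) ^ 2 * wilsonBGOfRecord F 2 (theta13OfThm1CCMWZBAx F 2 j γ a₀ ε₀ ε₂₉ B₃ B₃' a₀ a₁ (Efl j γ ε₀ ε₂₉ B₃ B₃' a₀ a₁) (fun p i => Real.log (B16ZLower.zNorm (SU 2) (gOfRecord₁₃Ax F 2 (theta13OfThm1CCMWZBAx F 2 j γ a₀ ε₀ ε₂₉ B₃ B₃' a₀ a₁ (fun _ _ => 0) (fun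 _ _ => 0)) p i ^ 2) ε))).εbg P (k + 1) U)
                - em (gOfRecord₁₃Ax F 2 (theta13OfThm1CCMWZBAx F 2 j γ a₀ ε₀ ε₂₉ B₃ B₃' a₀ a₁ (Efl j γ ε₀ ε₂₉ B₃ B₃' a₀ a₁) (fun p i => Real.log (B16ZLower.zNorm (SU 2) (gOfRecord₁₃Ax F 2 (theta13OfThm1CCMWZBAx F 2 j γ a₀ ε₀ ε₂₉ B₃ B₃' a₀ a₁ (fun _ _ => 0) (fun _ _ => 0)) p i ^ 2) ε))) P (k + 1)) * (Fintype.card (Site (F.P P.K) (k + 1)) : ℝ)) ≤ densOfRecord₁₃Chi F 2 (theta13OfThm1CCMWZBAx F 2 j γ a₀ ε₀ ε₂₉ B₃ B₃' a₀ a₁ (Efl j γ ε₀ ε₂₉ B₃ B₃' a₀ a₁) (fun p i => Real.log (B16ZLower.zNorm (SU 2) (gOfRecord₁₃Ax F 2 (theta13OfThm1CCMWZBAx F 2 j γ a₀ ε₀ ε₂₉ B₃ B₃' a₀ a₁ (fun _ _ => 0) (fun _ _ => 0)) p i ^ 2) ε))) (chiFixed29Ax F 2 (numerics7OfThm1CCM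 F.L j ε₀ B₃ B₃' a₀ a₁) ε₂₉) P (k + 1) U ∧
          densOfRecord₁₃Chi F 2 (theta13OfThm1CCMWZBAx F 2 j γ a₀ ε₀ ε₂₉ B₃ B₃' a₀ a₁ (Efl j γ ε₀ ε₂₉ B₃ B₃' a₀ a₁) (fun p i => Real.log (B16ZLower.zNorm (SU 2) (gOfRecord₁₃Ax F 2 (theta13OfThm1CCMWZBAx F 2 j γ a₀ ε₀ ε₂₉ B₃ B₃' a₀ a₁ (fun _ _ => 0) (fun _ _ => 0)) p i ^ 2) ε))) (chiFixed29Ax F 2 (numerics7OfThm1CCM F.L j ε₀ B₃ B₃' a₀ a₁) ε₂₉) P (k + 1) U ≤ Real.exp (ep (gOfRecord₁₃Ax F 2 (theta13OfThm1CCMWZBAx F 2 j γ a₀ ε₀ ε₂₉ B₃ B₃' a₀ a₁ (Efl j γ ε₀ ε₂₉ B₃ B₃' a₀ a₁) (fun p i => Real.log (B16ZLower.zNorm (SU 2) (gOfRecord₁₃Ax F 2 (theta13OfThm1CCMWZBAx F 2 j γ a₀ ε₀ ε₂₉ B₃ B₃' a₀ a₁ (fun _ _ => 0) (fun _ _ =>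 0)) p i ^ 2) ε))) P (k + 1)) * (Fintype.card (Site (F.P P.K) (k + 1)) : ℝ))))
    -- ★ THE COFINAL β-SOCKET (director-ym №402 (R) ∕ P3 g84 spec (R1)): K0⁷'s sign-free β-BOX AND NODE O's four RUN ROWS AT A RADIUS SUPPLIED BY THE PRODUCER — for every ceiling `a > 0` SOME
    -- `0 < a₀ ≤ a`, SOME member letters `(j, ε₀, B₃, B₃′, a₁, Efl, logz)`, level `γ₀`, threshold `ε₂₉`, bound `β′` with the abs box of β₁₃ at the doors' HALF-WINDOW Z3 member
    -- (= the body of `K0V23Stub3DoorSuppliers.K0BoxCofinalRadii` ✓p781725 at `F`, conjunct for conjunct) ∧ NODE O's rows (i) (iv) (C) at THAT β at SOME level `γ₁` (K1⁹'s own rows conjunct);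
    -- replaces engine v2's `h3` (the ∀-radius V23 stub text) AND `hrowsRF` (the ∀-door run rows): the socket bills the producer at ITS radius, not at every small radius
    (hβc : ∀ a : ℝ, 0 < a → ∃ a₀ : ℝ, 0 < a₀ ∧ a₀ ≤ a ∧
      ∃ (γ₀ ε₂₉ β' : ℝ) (j : ℕ) (ε₀ B₃ B₃' a₁ : ℝ) (Efl logz : B12.RunParams → ℕ → ℝ), 0 < γ₀ ∧ 0 < ε₂₉ ∧
        BetaLowerH (-β') γ₀ (betaOfRecord₁₃Ax F 2 (theta13OfThm1CCMWZBAx F 2 j (1 / 2) a₀ ε₀ ε₂₉ B₃ B₃' a₀ a₁ Efl logz)) ∧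
        BetaUpperH β' γ₀ (betaOfRecord₁₃Ax F 2 (theta13OfThm1CCMWZBAx F 2 j (1 / 2) a₀ ε₀ ε₂₉ B₃ B₃' a₀ a₁ Efl logz)) ∧
        ∃ (b : ℕ → ℝ) (r γ₁ M : ℝ), 0 < γ₁ ∧
          (∀ (n : ℕ) (gs : ℕ → ℝ), RGEqH n (betaOfRecord₁₃Ax F 2 (theta13OfThm1CCMWZBAx F 2 j (1 / 2) a₀ ε₀ ε₂₉ B₃ B₃' a₀ a₁ Efl logz)) gs → Step.InInterval γ₁ n gs → ∀ k, k ≤ n → |betaOfRecord₁₃Ax F 2 (theta13OfThm1CCMWZBAx F 2 j (1 / 2) a₀ ε₀ ε₂₉ B₃ B₃' a₀ a₁ Efl logz) k (prefixOf gs k) - b k| ≤ r) ∧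
          (∀ (n : ℕ) (gs : ℕ → ℝ), RGEqH n (betaOfRecord₁₃Ax F 2 (theta13OfThm1CCMWZBAx F 2 j (1 / 2) a₀ ε₀ ε₂₉ B₃ B₃' a₀ a₁ Efl logz)) gs → Step.InInterval γ₁ n gs → ∀ k, k ≤ n → -M ≤ ∑ i ∈ Finset.Ico k n, betaOfRecord₁₃Ax F 2 (theta13OfThm1CCMWZBAx F 2 j (1 / 2) a₀ ε₀ ε₂₉ B₃ B₃' a₀ a₁ Efl logz) i (prefixOf gs i)) ∧
          ∀ k : ℕ, ContinuousOn (fun x : ℝ => betaOfRecord₁₃Ax F 2 (theta13OfThm1CCMWZBAx F 2 j (1 / 2) a₀ ε₀ ε₂₉ B₃ B₃' a₀ a₁ Efl logz) k (clampPrefix (betaOfRecord₁₃Ax F 2 (theta13OfThm1CCMWZBAx F 2 j (1 / 2) a₀ ε₀ ε₂₉ B₃ B₃' a₀ a₁ Efl logz)) γ₁ k x))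
            {x : ℝ | 0 < x ∧ x ≤ γ₁ ∧ ∀ i, i ≤ k → 1 / γ₁ ^ 2 ≤ Y (betaOfRecord₁₃Ax F 2 (theta13OfThm1CCMWZBAx F 2 j (1 / 2) a₀ ε₀ ε₂₉ B₃ B₃' a₀ a₁ Efl logz)) γ₁ i x}) :
    ∃ (θ' : Stage13HParams F 2) (h' : θ'.Provisos₁₃SepCoPHAx F 2) (v' : Revision₁₃Ax F 2 θ' h'), (θ'.ZhUnity F 2 ∧ θ'.SlotsNondegenerate₁₃Ax F 2) ∧ θ'.Admissible F 2 ∧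
      B16.EndStatementBPrinted (datumOfRecord₁₃SepCoPHVAx F 2 θ' h' v').C ∧
      (∃ γ₁ : ℝ, 0 < γ₁ ∧ ∀ γ : ℝ, 0 < γ → γ ≤ γ₁ → ∃ P : B12.RunParams, 1 ≤ P.K ∧ ((datumOfRecord₁₃SepCoPHVAx F 2 θ' h' v').C P).flow.InInterval γ P.K) ∧
      ∃ (b : ℕ → ℝ) (r γ₀ M : ℝ), 0 < γ₀ ∧
        (∀ (n : ℕ) (gs : ℕ → ℝ), RGEqH n (betaOfRecord₁₃Ax F 2 θ'.toStage13Params) gs → Step.InInterval γ₀ n gs → ∀ k, k ≤ n → |betaOfRecord₁₃Ax F 2 θ'.toStage13Params k (prefixOf gs k) - b k| ≤ r) ∧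
        (∀ (n : ℕ) (gs : ℕ → ℝ), RGEqH n (betaOfRecord₁₃Ax F 2 θ'.toStage13Params) gs → Step.InInterval γ₀ n gs → ∀ k, k ≤ n → -M ≤ ∑ j ∈ Finset.Ico k n, betaOfRecord₁₃Ax F 2 θ'.toStage13Params j (prefixOf gs j)) ∧
        ∀ k : ℕ, ContinuousOn (fun x : ℝ => betaOfRecord₁₃Ax F 2 θ'.toStage13Params k (clampPrefix (betaOfRecord₁₃Ax F 2 θ'.toStage13Params) γ₀ k x))
          {x : ℝ | 0 < x ∧ x ≤ γ₀ ∧ ∀ j', j' ≤ k → 1 / γ₀ ^ 2 ≤ Y (betaOfRecord₁₃Ax F 2 θ'.toStage13Params) γ₀ j' x} := by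
  -- `8 ≤ L` (for `positivity` on the ceiling); the engine's radius ceiling `a₀ ≤ 1/(109824·L²)`
  have hL8 : (8 : ℝ) ≤ (F.L : ℝ) := by
    have h1 := eight_le_L_stage3OfFamily F
    have h2 := stage3OfFamily_ℓ₆_succ F
    exact_mod_cast (show (8 : ℕ) ≤ F.L by omega)
  have hL2 : (0 : ℝ) < 109824 * (F.L : ℝ) ^ 2 := by positivity
  -- ★ THE RADIUS FROM THE PRODUCER (director-ym №402 (R) ∕ P3 g84 (R1)): stub 1ᴮ's ∃-radius `ā` (k0 `K0V23Stub3NonVacuity.exists_radius_antecedentsZB_inhabited_below`: below `ā` the ᴮ (8)-sentence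
  -- and (9)-token are jointly inhabited — stub 1ᴮ PROVED + 53′ + the (9)-supplier with [6] Prop. 6 printed) and the engine's ceiling `1∕(109824·L²)` are handed to the socket as `a := min ā (1∕(109824·L²))`;
  -- the socket returns SOME `0 < a₀ ≤ a` with the producer's member letters, `γ₀`, `ε₂₉`, `β′`, the abs box and NODE O's rows THERE
  obtain ⟨ā, hā, hinh⟩ := exists_radius_antecedentsZB_inhabited_below F
  obtain ⟨a₀, ha₀, ha₀le, γ₀, ε₂₉, β', j₁, ε₀₁, C₃, C₃', c₁', Efl₁, logz₁, hγ0, hε', hlow₁, hup₁, hrows₁⟩ :=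
    hβc (min ā (1 / (109824 * (F.L : ℝ) ^ 2))) (lt_min hā (one_div_pos.mpr hL2))
  have ha₀ρ : a₀ ≤ 1 / (109824 * (F.L : ℝ) ^ 2) := ha₀le.trans (min_le_right _ _)
  -- the K0 door AT THE PRODUCER's RADIUS: `(j, c′, c₀, c₁; B₃, B₉, a₁′)` with riders, signs, the ᴮ (8)-sentence `h15` and (9)-token `h9` under `A‴` at `(lamDatum F, dataSmall7LamTopOf F 2)`
  obtain ⟨j, c', c₀, c₁, B₃, B₉, a₁', hc', hc₀, hc₁, hB₃, hB9, ha₁', h15, h9⟩ := hinh a₀ ha₀ (ha₀le.trans (min_le_left _ _))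
  -- the producer's box RE-LETTERED to the door's letter-free half-window member (the census: β₁₃ at the half-window Z3 member reads `(F; a₀, ε₂₉)` only — `rfl`, k0's
  -- `K0V23Stub3Sockets.betaOfRecord₁₃_zbRegime_letterBlind` stated inline to stay off the Theses cone), then the window SHRUNK to `0 < γ ≤ ½` with the two letters (n07-w3's `windowLetters_of_absBoxH`)
  have census : betaOfRecord₁₃Ax F 2 (theta13OfThm1CCMWZBAx F 2 j (1 / 2) a₀ a₀ ε₂₉ B₃ B₉ a₀ a₁' (fun _ _ => 0) (fun _ _ => 0)) =
      betaOfRecord₁₃Ax F 2 (theta13OfThm1CCMWZBAx F 2 j₁ (1 / 2) a₀ ε₀₁ ε₂₉ C₃ C₃' a₀ c₁' Efl₁ logz₁) := rfl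
  have hlow₀ : BetaLowerH (-β') γ₀ (betaOfRecord₁₃Ax F 2 (theta13OfThm1CCMWZBAx F 2 j (1 / 2) a₀ a₀ ε₂₉ B₃ B₉ a₀ a₁' (fun _ _ => 0) (fun _ _ => 0))) := by
    rw [census]; exact hlow₁
  have hup₀ : BetaUpperH β' γ₀ (betaOfRecord₁₃Ax F 2 (theta13OfThm1CCMWZBAx F 2 j (1 / 2) a₀ a₀ ε₂₉ B₃ B₉ a₀ a₁' (fun _ _ => 0) (fun _ _ => 0))) := by
    rw [census]; exact hup₁
  obtain ⟨γ, hγpos, hγh, hl, hu, hlow', hup'⟩ := windowLetters_of_absBoxH hγ0 hlow₀ hup₀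
  have hL0 : (0 : ℝ) < (F.L : ℝ) := by exact_mod_cast lt_trans Nat.zero_lt_one F.hL.2
  have hBpos : (0 : ℝ) < B₃ := lt_of_lt_of_le (mul_pos two_pos (pow_pos hL0 2)) hB₃
  -- edition «N09T5»: the door's small-field threshold at the TOP of the window, `ε₀ := a₀` (an opaque letter pinned by `hε₀def`, fed to every per-door family's `hε₀ρ`)
  obtain ⟨ε₀, hε₀def⟩ : ∃ ε₀ : ℝ, ε₀ = a₀ := ⟨_, rfl⟩
  have hε : 0 < ε₀ := by rw [hε₀def]; exact ha₀
  -- the box at the WINDOW-EDITION letter-free member (node00's half-window transfer) and at the engine's member (β of the Z3 member is letter- and ε₀-blind by `rfl`)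
  have hloW : BetaLowerH (-β') γ (betaOfRecord₁₃Ax F 2 (theta13OfThm1CCMWZBAx F 2 j γ a₀ ε₀ ε₂₉ B₃ B₉ a₀ a₁' (fun _ _ => 0) (fun _ _ => 0))) := by
    rw [hε₀def]; exact betaLowerH_theta13OfThm1CCMWZBAx_of_half (Efl := fun _ _ => 0) (logz := fun _ _ => 0) hγh hlow'
  have hupW : BetaUpperH β' γ (betaOfRecord₁₃Ax F 2 (theta13OfThm1CCMWZBAx F 2 j γ a₀ ε₀ ε₂₉ B₃ B₉ a₀ a₁' (fun _ _ => 0) (fun _ _ => 0))) := by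
    rw [hε₀def]; exact betaUpperH_theta13OfThm1CCMWZBAx_of_half (Efl := fun _ _ => 0) (logz := fun _ _ => 0) hγh hup'
  have hloZ : BetaLowerH _ γ (betaOfRecord₁₃Ax F 2 (theta13OfThm1CCMWZBAx F 2 j γ a₀ ε₀ ε₂₉ B₃ B₉ a₀ a₁' (Efl j γ ε₀ ε₂₉ B₃ B₉ a₀ a₁') (fun p i => Real.log (B16ZLower.zNorm (SU 2) (gOfRecord₁₃Ax F 2 (theta13OfThm1CCMWZBAx F 2 j γ a₀ ε₀ ε₂₉ B₃ B₉ a₀ a₁' (fun _ _ => 0) (fun _ _ => 0)) p i ^ 2) ε)))) := hloW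
  have hupZ : BetaUpperH _ γ (betaOfRecord₁₃Ax F 2 (theta13OfThm1CCMWZBAx F 2 j γ a₀ ε₀ ε₂₉ B₃ B₉ a₀ a₁' (Efl j γ ε₀ ε₂₉ B₃ B₉ a₀ a₁') (fun p i => Real.log (B16ZLower.zNorm (SU 2) (gOfRecord₁₃Ax F 2 (theta13OfThm1CCMWZBAx F 2 j γ a₀ ε₀ ε₂₉ B₃ B₉ a₀ a₁' (fun _ _ => 0) (fun _ _ => 0)) p i ^ 2) ε)))) := hupW
  -- ★ NODE O's rows RE-LETTERED AND MOVED to the window-edition member (this seat's `K1RunRowsBoxCongr.runRows_theta13OfThm1CCMWZB_window_of_half`: the four rows read β on the boxes of their own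
  -- level only; the level lands at `min γ₁ γ`) — replaces engine v2's read of the ∀-door binder `hrowsRF` at this door
  have hrowsE : ∃ (b : ℕ → ℝ) (r γ₀ M : ℝ), 0 < γ₀ ∧
      (∀ (n : ℕ) (gs : ℕ → ℝ), RGEqH n (betaOfRecord₁₃Ax F 2 (theta13OfThm1CCMWZBAx F 2 j γ a₀ ε₀ ε₂₉ B₃ B₉ a₀ a₁' (Efl j γ ε₀ ε₂₉ B₃ B₉ a₀ a₁') (fun p i => Real.log (B16ZLower.zNorm (SU 2) (gOfRecord₁₃Ax F 2 (theta13OfThm1CCMWZBAx F 2 j γ a₀ ε₀ ε₂₉ B₃ B₉ a₀ a₁' (fun _ _ => 0) (fun _ _ => 0)) p i ^ 2) ε)))) gs → Step.InInterval γ₀ n gs → ∀ k, k ≤ n → |betaOfRecord₁₃Ax F 2 (theta13OfThm1CCMWZBAx F 2 j γ a₀ ε₀ ε₂₉ B₃ B₉ a₀ a₁' (Efl j γ ε₀ ε₂₉ B₃ B₉ a₀ a₁') (fun p i => Real.log (B16ZLower.zNorm (SU 2) (gOfRecord₁₃Ax F 2 (theta13OfThm1CCMWZBAx F 2 j γ a₀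 ε₀ ε₂₉ B₃ B₉ a₀ a₁' (fun _ _ => 0) (fun _ _ => 0)) p i ^ 2) ε))) k (prefixOf gs k) - b k| ≤ r) ∧
      (∀ (n : ℕ) (gs : ℕ → ℝ), RGEqH n (betaOfRecord₁₃Ax F 2 (theta13OfThm1CCMWZBAx F 2 j γ a₀ ε₀ ε₂₉ B₃ B₉ a₀ a₁' (Efl j γ ε₀ ε₂₉ B₃ B₉ a₀ a₁') (fun p i => Real.log (B16ZLower.zNorm (SU 2) (gOfRecord₁₃Ax F 2 (theta13OfThm1CCMWZBAx F 2 j γ a₀ ε₀ ε₂₉ B₃ B₉ a₀ a₁' (fun _ _ => 0) (fun _ _ => 0)) p i ^ 2) ε)))) gs → Step.InInterval γ₀ n gs → ∀ k, k ≤ n → -M ≤ ∑ i ∈ Finset.Ico k n, betaOfRecord₁₃Ax F 2 (theta13OfThm1CCMWZBAx F 2 j γ a₀ ε₀ ε₂₉ B₃ B₉ a₀ a₁' (Efl j γ ε₀ ε₂₉ B₃ B₉ a₀ a₁') (fun p i => Real.log (B16ZLower.zNorm (SU 2) (gOfRecord₁₃Ax F 2 (theta13OfThm1CCMWZBAx F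 2 j γ a₀ ε₀ ε₂₉ B₃ B₉ a₀ a₁' (fun _ _ => 0) (fun _ _ => 0)) p i ^ 2) ε))) i (prefixOf gs i)) ∧
      ∀ k : ℕ, ContinuousOn (fun x : ℝ => betaOfRecord₁₃Ax F 2 (theta13OfThm1CCMWZBAx F 2 j γ a₀ ε₀ ε₂₉ B₃ B₉ a₀ a₁' (Efl j γ ε₀ ε₂₉ B₃ B₉ a₀ a₁') (fun p i => Real.log (B16ZLower.zNorm (SU 2) (gOfRecord₁₃Ax F 2 (theta13OfThm1CCMWZBAx F 2 j γ a₀ ε₀ ε₂₉ B₃ B₉ a₀ a₁' (fun _ _ => 0) (fun _ _ => 0)) p i ^ 2) ε))) k (clampPrefix (betaOfRecord₁₃Ax F 2 (theta13OfThm1CCMWZBAx F 2 j γ a₀ ε₀ ε₂₉ B₃ B₉ a₀ a₁' (Efl j γ ε₀ ε₂₉ B₃ B₉ a₀ a₁') (fun p i => Real.log (B16ZLower.zNorm (SU 2) (gOfRecord₁₃Ax F 2 (theta13OfThm1CCMWZBAx F 2 j γ a₀ ε₀ ε₂₉ B₃ B₉ a₀ a₁' (fun _ _ => 0) (fun _ _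 => 0)) p i ^ 2) ε)))) γ₀ k x))
        {x : ℝ | 0 < x ∧ x ≤ γ₀ ∧ ∀ i, i ≤ k → 1 / γ₀ ^ 2 ≤ Y (betaOfRecord₁₃Ax F 2 (theta13OfThm1CCMWZBAx F 2 j γ a₀ ε₀ ε₂₉ B₃ B₉ a₀ a₁' (Efl j γ ε₀ ε₂₉ B₃ B₉ a₀ a₁') (fun p i => Real.log (B16ZLower.zNorm (SU 2) (gOfRecord₁₃Ax F 2 (theta13OfThm1CCMWZBAx F 2 j γ a₀ ε₀ ε₂₉ B₃ B₉ a₀ a₁' (fun _ _ => 0) (fun _ _ => 0)) p i ^ 2) ε)))) γ₀ i x} := by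
    rw [hε₀def]; exact runRows_theta13OfThm1CCMWZBAx_window_of_half hγpos hγh hrows₁
  have H := hcompBoth_theta13OfThm1CCMWZBAx_of_betaBoxSignFree (F := F) (N := 2) (j := j) (εbg := a₀) (ε₀ := ε₀) (ε₂₉ := ε₂₉) (Efl := fun _ _ => 0) (logz := fun _ _ => 0) hγh hBpos.le hB9.le ha₀.le ha₁'.le hloW hupW hl hu
  -- the GRID-GUARD Z3 provisos ON THE ᴮ ROAD (k0-s1-w1's `…GuardedZBLam` one-call closer; print's data transfer `hDat_dataSmall7LamTopOf`; the Stage-2 SEAM AS A THEOREM `hseam_holds`)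
  have hPZ : (theta13OfThm1CCMWZBAx F 2 j γ a₀ ε₀ ε₂₉ B₃ B₉ a₀ a₁' (Efl j γ ε₀ ε₂₉ B₃ B₉ a₀ a₁') (fun p i => Real.log (B16ZLower.zNorm (SU 2) (gOfRecord₁₃Ax F 2 (theta13OfThm1CCMWZBAx F 2 j γ a₀ ε₀ ε₂₉ B₃ B₉ a₀ a₁' (fun _ _ => 0) (fun _ _ => 0)) p i ^ 2) ε))).Provisos₁₃SepCoPAx F 2 :=
    provisos₁₃SepCoP_theta13OfThm1CCMWZBAx_gridGuard_of_thm1RegSepCoP7MGB_of_thm1GaugeGB_lam F 2 hγpos hγh ha₀ hε hε' hBpos.le hB9.le ha₀ ha₁' hc' hc₀ hc₁ h15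
      (variationalThm1GaugeRegSepCoP7MGB_of_gauge9TopStepGB h9) (hDat_dataSmall7LamTopOfAx F 2) (hseamAx_rfl F) H.1 H.2
  -- dag-n11-d ✓p773221: the engine's FOUR door rows at `θᴳᶻᴮ(π)` from the provisos at `θᴴᶻᴮ(π)` in ONE conjunction (residue-free home of (Z-4)'s rows)
  obtain ⟨hP, hA, hU, hlaws⟩ := doorRows_gaussPinH_ofHistoryBlind_theta13OfThm1CCMWZB (j := j) (γ := γ) (εbg := a₀) (ε₀ := ε₀) (ε₂₉ := ε₂₉) (B₃ := B₃) (B₃' := B₉) (a₀ := a₀) (a₁ := a₁') (Efl := (Efl j γ ε₀ ε₂₉ B₃ B₉ a₀ a₁')) (logz := (fun p i => Real.log (B16ZLower.zNorm (SU 2) (gOfRecord₁₃Ax F 2 (theta13OfThm1CCMWZBAx F 2 j γ a₀ ε₀ ε₂₉ B₃ B₉ a₀ a₁' (fun _ _ => 0) (fun _ _ => 0)) p i ^ 2) ε))) (chiFixed29Ax F 2 (numerics7OfThm1CCM F.L j ε₀ B₃ B₉ a₀ a₁') ε₂₉) hγpos hγh ha₀ hε hε' hBpos.le hB9.le ha₀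 ha₁' (ZrOfRecord₁₃Ax F 2 (theta13OfThm1CCMWZBAx F 2 j γ a₀ ε₀ ε₂₉ B₃ B₉ a₀ a₁' (Efl j γ ε₀ ε₂₉ B₃ B₉ a₀ a₁') (fun p i => Real.log (B16ZLower.zNorm (SU 2) (gOfRecord₁₃Ax F 2 (theta13OfThm1CCMWZBAx F 2 j γ a₀ ε₀ ε₂₉ B₃ B₉ a₀ a₁' (fun _ _ => 0) (fun _ _ => 0)) p i ^ 2) ε)))) hPZ.ofCured.ofHistoryBlind
  obtain ⟨σ, hσ, hops⟩ := h11N hγpos hγh hε hε' hBpos.le hB9.le ha₀ ha₁' ha₀ρ hε₀def hloZ hupZ hl hu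
  -- N13's `h13` family of p650613 §2 ASSEMBLED: level 0 = dag-n13-w1 p643638 at the printed z (+ NODE O row (ii) + `hEfl`); levels ≥ 1 = the displayed a.e. rows; `em ∕ ep := max`
  have mono : ∀ {χ A T d e₁ e₂ p₁ p₂ : ℝ}, 0 ≤ χ → 0 ≤ T → e₁ ≤ e₂ → p₁ ≤ p₂ →
      (χ * Real.exp (A - e₁ * T) ≤ d ∧ d ≤ Real.exp (p₁ * T)) → (χ * Real.exp (A - e₂ * T) ≤ d ∧ d ≤ Real.exp (p₂ * T)) := by
    intro χ A T d e₁ e₂ p₁ p₂ hχ hT he hp h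
    have h1 := mul_le_mul_of_nonneg_right he hT
    exact ⟨le_trans (mul_le_mul_of_nonneg_left (Real.exp_le_exp.mpr (by linarith)) hχ) h.1, h.2.trans (Real.exp_le_exp.mpr (mul_le_mul_of_nonneg_right hp hT))⟩
  obtain ⟨CE, hCE, hE⟩ := hEfl j γ ε₀ ε₂₉ B₃ B₉ a₀ a₁'
  obtain ⟨_, _, γR, M, hγR, -, hpsR, -⟩ := id hrowsE
  obtain ⟨γ₁₃, hγ₁₃, em, ep, hae⟩ := h13posF hγpos hγh hε hε' hBpos.le hB9.le ha₀ ha₁' ha₀ρ hε₀def hloZ hupZ hl hu hP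
  have hγm1 : min γ₁₃ (min γR 1) ≤ 1 := (min_le_right _ _).trans (min_le_right _ _)
  have hγmR : min γ₁₃ (min γR 1) ≤ γR := (min_le_right _ _).trans (min_le_left _ _)
  -- level 0 at the printed z, spelled as in p650613 §2's `h13` (dag-n13-w1's theorem, window converted by `rfl` faces, β ∕ g ∕ χ ∕ backgrounds of the Z member = the blind member's)
  have h0 : ∀ P : B12.RunParams, ((datumOfRecord₁₃SepCoPHAx F 2 (gaussPinH (Stage13HParams.ofHistoryBlind F 2 ⟨theta13OfThm1CCMWZBAx F 2 j γ a₀ ε₀ ε₂₉ B₃ B₉ a₀ a₁' (Efl j γ ε₀ ε₂₉ B₃ B₉ a₀ a₁') (fun p i => Real.log (B16ZLower.zNorm (SU 2) (gOfRecord₁₃Ax F 2 (theta13OfThm1CCMWZBAx F 2 j γ a₀ ε₀ ε₂₉ B₃ B₉ a₀ a₁' (fun _ _ => 0) (fun _ _ => 0)) p i ^ 2) ε)), ZrOfRecord₁₃Ax F 2 (theta13OfThm1CCMWZBAx F 2 j γ a₀ ε₀ ε₂₉ B₃ B₉ a₀ a₁' (Efl j γ ε₀ ε₂₉ B₃ B₉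 a₀ a₁') (fun p i => Real.log (B16ZLower.zNorm (SU 2) (gOfRecord₁₃Ax F 2 (theta13OfThm1CCMWZBAx F 2 j γ a₀ ε₀ ε₂₉ B₃ B₉ a₀ a₁' (fun _ _ => 0) (fun _ _ => 0)) p i ^ 2) ε)))⟩) (chiFixed29Ax F 2 (numerics7OfThm1CCM F.L j ε₀ B₃ B₉ a₀ a₁') ε₂₉)) hP).C P).flow.InInterval (min γ₁₃ (min γR 1)) P.K →
      ∀ U : GaugeField (F.P P.K) 0 (SU 2),
        chiβOfRecord₁₃Ax F 2 (theta13OfThm1CCMWZBAx F 2 j γ a₀ ε₀ ε₂₉ B₃ B₉ a₀ a₁' (Efl j γ ε₀ ε₂₉ B₃ B₉ a₀ a₁') (fun p i => Real.log (B16ZLower.zNorm (SU 2) (gOfRecord₁₃Ax F 2 (theta13OfThm1CCMWZBAx F 2 j γ a₀ ε₀ ε₂₉ B₃ B₉ a₀ a₁' (fun _ _ => 0) (fun _ _ => 0)) p i ^ 2) ε))) P.K (gOfRecord₁₃Ax F 2 (theta13OfThm1CCMWZBAx F 2 j γ a₀ ε₀ ε₂₉ B₃ B₉ a₀ a₁'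 (Efl j γ ε₀ ε₂₉ B₃ B₉ a₀ a₁') (fun p i => Real.log (B16ZLower.zNorm (SU 2) (gOfRecord₁₃Ax F 2 (theta13OfThm1CCMWZBAx F 2 j γ a₀ ε₀ ε₂₉ B₃ B₉ a₀ a₁' (fun _ _ => 0) (fun _ _ => 0)) p i ^ 2) ε))) P) 0 U *
              Real.exp (-(1 / (gOfRecord₁₃Ax F 2 (theta13OfThm1CCMWZBAx F 2 j γ a₀ ε₀ ε₂₉ B₃ B₉ a₀ a₁' (Efl j γ ε₀ ε₂₉ B₃ B₉ a₀ a₁') (fun p i => Real.log (B16ZLower.zNorm (SU 2) (gOfRecord₁₃Ax F 2 (theta13OfThm1CCMWZBAx F 2 j γ a₀ ε₀ ε₂₉ B₃ B₉ a₀ a₁' (fun _ _ => 0) (fun _ _ => 0)) p i ^ 2) ε))) P 0)) ^ 2 * wilsonBGOfRecord F 2 (theta13OfThm1CCMWZBAx F 2 j γ a₀ ε₀ ε₂₉ B₃ B₉ a₀ a₁' (Efl j γ ε₀ ε₂₉ B₃ B₉ a₀ a₁') (fun p i => Real.log (B16ZLower.zNorm (SU 2) (gOfRecord₁₃Ax F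 2 (theta13OfThm1CCMWZBAx F 2 j γ a₀ ε₀ ε₂₉ B₃ B₉ a₀ a₁' (fun _ _ => 0) (fun _ _ => 0)) p i ^ 2) ε))).εbg P 0 U
                - (4 * max (numerics7OfThm1CCM F.L j ε₀ B₃ B₉ a₀ a₁').logσ₀ 0 + B16ZLower.CzSU 2 ε + CE + 12 * (1 / gOfRecord₁₃Ax F 2 (theta13OfThm1CCMWZBAx F 2 j γ a₀ ε₀ ε₂₉ B₃ B₉ a₀ a₁' (Efl j γ ε₀ ε₂₉ B₃ B₉ a₀ a₁') (fun p i => Real.log (B16ZLower.zNorm (SU 2) (gOfRecord₁₃Ax F 2 (theta13OfThm1CCMWZBAx F 2 j γ a₀ ε₀ ε₂₉ B₃ B₉ a₀ a₁' (fun _ _ => 0) (fun _ _ => 0)) p i ^ 2) ε))) P 0) ^ 2) * (Fintype.card (Site (F.P P.K) 0) : ℝ)) ≤ densOfRecord₁₃Chi F 2 (theta13OfThm1CCMWZBAx F 2 j γ a₀ ε₀ ε₂₉ B₃ B₉ a₀ a₁' (Efl j γ ε₀ ε₂₉ B₃ B₉ a₀ a₁') (fun p i => Real.log (B16ZLower.zNorm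 (SU 2) (gOfRecord₁₃Ax F 2 (theta13OfThm1CCMWZBAx F 2 j γ a₀ ε₀ ε₂₉ B₃ B₉ a₀ a₁' (fun _ _ => 0) (fun _ _ => 0)) p i ^ 2) ε))) (chiFixed29Ax F 2 (numerics7OfThm1CCM F.L j ε₀ B₃ B₉ a₀ a₁') ε₂₉) P 0 U ∧
          densOfRecord₁₃Chi F 2 (theta13OfThm1CCMWZBAx F 2 j γ a₀ ε₀ ε₂₉ B₃ B₉ a₀ a₁' (Efl j γ ε₀ ε₂₉ B₃ B₉ a₀ a₁') (fun p i => Real.log (B16ZLower.zNorm (SU 2) (gOfRecord₁₃Ax F 2 (theta13OfThm1CCMWZBAx F 2 j γ a₀ ε₀ ε₂₉ B₃ B₉ a₀ a₁' (fun _ _ => 0) (fun _ _ => 0)) p i ^ 2) ε))) (chiFixed29Ax F 2 (numerics7OfThm1CCM F.L j ε₀ B₃ B₉ a₀ a₁') ε₂₉) P 0 U ≤ Real.exp ((4 * ((dimSU 2 : ℕ) : ℝ) * (Real.log (gOfRecord₁₃Ax F 2 (theta13OfThm1CCMWZBAx F 2 j γ a₀ ε₀ ε₂₉ B₃ B₉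 a₀ a₁' (Efl j γ ε₀ ε₂₉ B₃ B₉ a₀ a₁') (fun p i => Real.log (B16ZLower.zNorm (SU 2) (gOfRecord₁₃Ax F 2 (theta13OfThm1CCMWZBAx F 2 j γ a₀ ε₀ ε₂₉ B₃ B₉ a₀ a₁' (fun _ _ => 0) (fun _ _ => 0)) p i ^ 2) ε))) P 0)⁻¹ + M / 2) + 4 * max (-(numerics7OfThm1CCM F.L j ε₀ B₃ B₉ a₀ a₁').logσ₀) 0 + CE) * (Fintype.card (Site (F.P P.K) 0) : ℝ)) := fun P hI U =>
    uv_zero_densOfRecord₁₃_theta13OfThm1CCMWZBAx_printedZ_of_eflAbs_of_inInterval_of_runPartialSumFloor F 2 j γ a₀ ε₀ ε₂₉ B₃ B₉ a₀ a₁' (Efl j γ ε₀ ε₂₉ B₃ B₉ a₀ a₁') hεz hCE hγm1 hγmR P (hE P) hpsR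
      (fun k hk => hI k hk) U
  have h13 : ∃ γ₁₃ : ℝ, 0 < γ₁₃ ∧ ∃ em ep : ℝ → ℝ,
        (∀ P : B12.RunParams, ((datumOfRecord₁₃SepCoPHAx F 2 (gaussPinH (Stage13HParams.ofHistoryBlind F 2 ⟨theta13OfThm1CCMWZBAx F 2 j γ a₀ ε₀ ε₂₉ B₃ B₉ a₀ a₁' (Efl j γ ε₀ ε₂₉ B₃ B₉ a₀ a₁') (fun p i => Real.log (B16ZLower.zNorm (SU 2) (gOfRecord₁₃Ax F 2 (theta13OfThm1CCMWZBAx F 2 j γ a₀ ε₀ ε₂₉ B₃ B₉ a₀ a₁' (fun _ _ => 0) (fun _ _ => 0)) p i ^ 2) ε)), ZrOfRecord₁₃Ax F 2 (theta13OfThm1CCMWZBAx F 2 j γ a₀ ε₀ ε₂₉ B₃ B₉ a₀ a₁' (Efl j γ ε₀ ε₂₉ B₃ B₉ a₀ a₁') (fun p i => Real.log (B16ZLower.zNorm (SU 2) (gOfRecord₁₃Ax F 2 (theta13OfThm1CCMWZBAx F 2 j γ a₀ ε₀ ε₂₉ B₃ B₉ a₀ a₁' (fun _ _ => 0) (fun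 _ _ => 0)) p i ^ 2) ε)))⟩) (chiFixed29Ax F 2 (numerics7OfThm1CCM F.L j ε₀ B₃ B₉ a₀ a₁') ε₂₉)) hP).C P).flow.InInterval γ₁₃ P.K → SLaw₁₃CoPHChi F 2 (gaussPinH (Stage13HParams.ofHistoryBlind F 2 ⟨theta13OfThm1CCMWZBAx F 2 j γ a₀ ε₀ ε₂₉ B₃ B₉ a₀ a₁' (Efl j γ ε₀ ε₂₉ B₃ B₉ a₀ a₁') (fun p i => Real.log (B16ZLower.zNorm (SU 2) (gOfRecord₁₃Ax F 2 (theta13OfThm1CCMWZBAx F 2 j γ a₀ ε₀ ε₂₉ B₃ B₉ a₀ a₁' (fun _ _ => 0) (fun _ _ => 0)) p i ^ 2) ε)), ZrOfRecord₁₃Ax F 2 (theta13OfThm1CCMWZBAx F 2 j γ a₀ ε₀ ε₂₉ B₃ B₉ a₀ a₁' (Efl j γ ε₀ ε₂₉ B₃ B₉ a₀ a₁') (fun p i => Real.log (B16ZLower.zNorm (SU 2) (gOfRecord₁₃Ax F 2 (theta13OfThm1CCMWZBAx F 2 j γ a₀ ε₀ ε₂₉ B₃ B₉ a₀ a₁'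 (fun _ _ => 0) (fun _ _ => 0)) p i ^ 2) ε)))⟩) (chiFixed29Ax F 2 (numerics7OfThm1CCM F.L j ε₀ B₃ B₉ a₀ a₁') ε₂₉)) (chiFixed29Ax F 2 (numerics7OfThm1CCM F.L j ε₀ B₃ B₉ a₀ a₁') ε₂₉) P 0 →
      ∀ U : GaugeField (F.P P.K) 0 (SU 2),
        chiβOfRecord₁₃Ax F 2 (theta13OfThm1CCMWZBAx F 2 j γ a₀ ε₀ ε₂₉ B₃ B₉ a₀ a₁' (Efl j γ ε₀ ε₂₉ B₃ B₉ a₀ a₁') (fun p i => Real.log (B16ZLower.zNorm (SU 2) (gOfRecord₁₃Ax F 2 (theta13OfThm1CCMWZBAx F 2 j γ a₀ ε₀ ε₂₉ B₃ B₉ a₀ a₁' (fun _ _ => 0) (fun _ _ => 0)) p i ^ 2) ε))) P.K (gOfRecord₁₃Ax F 2 (theta13OfThm1CCMWZBAx F 2 j γ a₀ ε₀ ε₂₉ B₃ B₉ a₀ a₁' (Efl j γ ε₀ ε₂₉ B₃ B₉ a₀ a₁') (fun p i => Real.log (B16ZLower.zNorm (SU 2) (gOfRecord₁₃Ax F 2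 (theta13OfThm1CCMWZBAx F 2 j γ a₀ ε₀ ε₂₉ B₃ B₉ a₀ a₁' (fun _ _ => 0) (fun _ _ => 0)) p i ^ 2) ε))) P) 0 U *
              Real.exp (-(1 / (gOfRecord₁₃Ax F 2 (theta13OfThm1CCMWZBAx F 2 j γ a₀ ε₀ ε₂₉ B₃ B₉ a₀ a₁' (Efl j γ ε₀ ε₂₉ B₃ B₉ a₀ a₁') (fun p i => Real.log (B16ZLower.zNorm (SU 2) (gOfRecord₁₃Ax F 2 (theta13OfThm1CCMWZBAx F 2 j γ a₀ ε₀ ε₂₉ B₃ B₉ a₀ a₁' (fun _ _ => 0) (fun _ _ => 0)) p i ^ 2) ε))) P 0) ^ 2 * wilsonBGOfRecord F 2 (theta13OfThm1CCMWZBAx F 2 j γ a₀ ε₀ ε₂₉ B₃ B₉ a₀ a₁' (Efl j γ ε₀ ε₂₉ B₃ B₉ a₀ a₁') (fun p i => Real.log (B16ZLower.zNorm (SU 2) (gOfRecord₁₃Ax F 2 (theta13OfThm1CCMWZBAx F 2 j γ a₀ ε₀ ε₂₉ B₃ B₉ a₀ a₁' (fun _ _ => 0) (fun _ _ => 0)) p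 i ^ 2) ε))).εbg P 0 U)
                - em (gOfRecord₁₃Ax F 2 (theta13OfThm1CCMWZBAx F 2 j γ a₀ ε₀ ε₂₉ B₃ B₉ a₀ a₁' (Efl j γ ε₀ ε₂₉ B₃ B₉ a₀ a₁') (fun p i => Real.log (B16ZLower.zNorm (SU 2) (gOfRecord₁₃Ax F 2 (theta13OfThm1CCMWZBAx F 2 j γ a₀ ε₀ ε₂₉ B₃ B₉ a₀ a₁' (fun _ _ => 0) (fun _ _ => 0)) p i ^ 2) ε))) P 0) * (Fintype.card (Site (F.P P.K) 0) : ℝ)) ≤ densOfRecord₁₃Chi F 2 (theta13OfThm1CCMWZBAx F 2 j γ a₀ ε₀ ε₂₉ B₃ B₉ a₀ a₁' (Efl j γ ε₀ ε₂₉ B₃ B₉ a₀ a₁') (fun p i => Real.log (B16ZLower.zNorm (SU 2) (gOfRecord₁₃Ax F 2 (theta13OfThm1CCMWZBAx F 2 j γ a₀ ε₀ ε₂₉ B₃ B₉ a₀ a₁' (fun _ _ => 0) (fun _ _ => 0)) p i ^ 2) ε))) (chiFixed29Ax F 2 (numerics7OfThm1CCM F.L j ε₀ B₃ B₉ a₀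 a₁') ε₂₉) P 0 U ∧
          densOfRecord₁₃Chi F 2 (theta13OfThm1CCMWZBAx F 2 j γ a₀ ε₀ ε₂₉ B₃ B₉ a₀ a₁' (Efl j γ ε₀ ε₂₉ B₃ B₉ a₀ a₁') (fun p i => Real.log (B16ZLower.zNorm (SU 2) (gOfRecord₁₃Ax F 2 (theta13OfThm1CCMWZBAx F 2 j γ a₀ ε₀ ε₂₉ B₃ B₉ a₀ a₁' (fun _ _ => 0) (fun _ _ => 0)) p i ^ 2) ε))) (chiFixed29Ax F 2 (numerics7OfThm1CCM F.L j ε₀ B₃ B₉ a₀ a₁') ε₂₉) P 0 U ≤ Real.exp (ep (gOfRecord₁₃Ax F 2 (theta13OfThm1CCMWZBAx F 2 j γ a₀ ε₀ ε₂₉ B₃ B₉ a₀ a₁' (Efl j γ ε₀ ε₂₉ B₃ B₉ a₀ a₁') (fun p i => Real.log (B16ZLower.zNorm (SU 2) (gOfRecord₁₃Ax F 2 (theta13OfThm1CCMWZBAx F 2 j γ a₀ ε₀ ε₂₉ B₃ B₉ a₀ a₁' (fun _ _ => 0) (fun _ _ => 0)) p i ^ 2) ε))) P 0) * (Fintype.card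 (Site (F.P P.K) 0) : ℝ))) ∧
        (∀ P : B12.RunParams, ((datumOfRecord₁₃SepCoPHAx F 2 (gaussPinH (Stage13HParams.ofHistoryBlind F 2 ⟨theta13OfThm1CCMWZBAx F 2 j γ a₀ ε₀ ε₂₉ B₃ B₉ a₀ a₁' (Efl j γ ε₀ ε₂₉ B₃ B₉ a₀ a₁') (fun p i => Real.log (B16ZLower.zNorm (SU 2) (gOfRecord₁₃Ax F 2 (theta13OfThm1CCMWZBAx F 2 j γ a₀ ε₀ ε₂₉ B₃ B₉ a₀ a₁' (fun _ _ => 0) (fun _ _ => 0)) p i ^ 2) ε)), ZrOfRecord₁₃Ax F 2 (theta13OfThm1CCMWZBAx F 2 j γ a₀ ε₀ ε₂₉ B₃ B₉ a₀ a₁' (Efl j γ ε₀ ε₂₉ B₃ B₉ a₀ a₁') (fun p i => Real.log (B16ZLower.zNorm (SU 2) (gOfRecord₁₃Ax F 2 (theta13OfThm1CCMWZBAx F 2 j γ a₀ ε₀ ε₂₉ B₃ B₉ a₀ a₁' (fun _ _ => 0) (fun _ _ => 0)) p i ^ 2) ε)))⟩) (chiFixed29Ax F 2 (numerics7OfThm1CCM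 F.L j ε₀ B₃ B₉ a₀ a₁') ε₂₉)) hP).C P).flow.InInterval γ₁₃ P.K → ∀ k, k + 1 ≤ P.K → SLaw₁₃CoPHChi F 2 (gaussPinH (Stage13HParams.ofHistoryBlind F 2 ⟨theta13OfThm1CCMWZBAx F 2 j γ a₀ ε₀ ε₂₉ B₃ B₉ a₀ a₁' (Efl j γ ε₀ ε₂₉ B₃ B₉ a₀ a₁') (fun p i => Real.log (B16ZLower.zNorm (SU 2) (gOfRecord₁₃Ax F 2 (theta13OfThm1CCMWZBAx F 2 j γ a₀ ε₀ ε₂₉ B₃ B₉ a₀ a₁' (fun _ _ => 0) (fun _ _ => 0)) p i ^ 2) ε)), ZrOfRecord₁₃Ax F 2 (theta13OfThm1CCMWZBAx F 2 j γ a₀ ε₀ ε₂₉ B₃ B₉ a₀ a₁' (Efl j γ ε₀ ε₂₉ B₃ B₉ a₀ a₁') (fun p i => Real.log (B16ZLower.zNorm (SU 2) (gOfRecord₁₃Ax F 2 (theta13OfThm1CCMWZBAx F 2 j γ a₀ ε₀ ε₂₉ B₃ B₉ a₀ a₁' (fun _ _ => 0) (fun _ _ => 0)) p i ^ 2) ε)))⟩)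 (chiFixed29Ax F 2 (numerics7OfThm1CCM F.L j ε₀ B₃ B₉ a₀ a₁') ε₂₉)) (chiFixed29Ax F 2 (numerics7OfThm1CCM F.L j ε₀ B₃ B₉ a₀ a₁') ε₂₉) P (k + 1) →
      ∀ᵐ U ∂(fieldMeasure (F.P P.K) (k + 1) (SU 2)),
        chiβOfRecord₁₃Ax F 2 (theta13OfThm1CCMWZBAx F 2 j γ a₀ ε₀ ε₂₉ B₃ B₉ a₀ a₁' (Efl j γ ε₀ ε₂₉ B₃ B₉ a₀ a₁') (fun p i => Real.log (B16ZLower.zNorm (SU 2) (gOfRecord₁₃Ax F 2 (theta13OfThm1CCMWZBAx F 2 j γ a₀ ε₀ ε₂₉ B₃ B₉ a₀ a₁' (fun _ _ => 0) (fun _ _ => 0)) p i ^ 2) ε))) P.K (gOfRecord₁₃Ax F 2 (theta13OfThm1CCMWZBAx F 2 j γ a₀ ε₀ ε₂₉ B₃ B₉ a₀ a₁' (Efl j γ ε₀ ε₂₉ B₃ B₉ a₀ a₁') (fun p i => Real.log (B16ZLower.zNorm (SU 2) (gOfRecord₁₃Ax F 2 (theta13OfThm1CCMWZBAx F 2 j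 γ a₀ ε₀ ε₂₉ B₃ B₉ a₀ a₁' (fun _ _ => 0) (fun _ _ => 0)) p i ^ 2) ε))) P) (k + 1) U *
              Real.exp (-(1 / (gOfRecord₁₃Ax F 2 (theta13OfThm1CCMWZBAx F 2 j γ a₀ ε₀ ε₂₉ B₃ B₉ a₀ a₁' (Efl j γ ε₀ ε₂₉ B₃ B₉ a₀ a₁') (fun p i => Real.log (B16ZLower.zNorm (SU 2) (gOfRecord₁₃Ax F 2 (theta13OfThm1CCMWZBAx F 2 j γ a₀ ε₀ ε₂₉ B₃ B₉ a₀ a₁' (fun _ _ => 0) (fun _ _ => 0)) p i ^ 2) ε))) P (k + 1)) ^ 2 * wilsonBGOfRecord F 2 (theta13OfThm1CCMWZBAx F 2 j γ a₀ ε₀ ε₂₉ B₃ B₉ a₀ a₁' (Efl j γ ε₀ ε₂₉ B₃ B₉ a₀ a₁') (fun p i => Real.log (B16ZLower.zNorm (SU 2) (gOfRecord₁₃Ax F 2 (theta13OfThm1CCMWZBAx F 2 j γ a₀ ε₀ ε₂₉ B₃ B₉ a₀ a₁' (fun _ _ => 0) (fun _ _ => 0)) p i ^ 2) ε))).εbg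 P (k + 1) U)
                - em (gOfRecord₁₃Ax F 2 (theta13OfThm1CCMWZBAx F 2 j γ a₀ ε₀ ε₂₉ B₃ B₉ a₀ a₁' (Efl j γ ε₀ ε₂₉ B₃ B₉ a₀ a₁') (fun p i => Real.log (B16ZLower.zNorm (SU 2) (gOfRecord₁₃Ax F 2 (theta13OfThm1CCMWZBAx F 2 j γ a₀ ε₀ ε₂₉ B₃ B₉ a₀ a₁' (fun _ _ => 0) (fun _ _ => 0)) p i ^ 2) ε))) P (k + 1)) * (Fintype.card (Site (F.P P.K) (k + 1)) : ℝ)) ≤ densOfRecord₁₃Chi F 2 (theta13OfThm1CCMWZBAx F 2 j γ a₀ ε₀ ε₂₉ B₃ B₉ a₀ a₁' (Efl j γ ε₀ ε₂₉ B₃ B₉ a₀ a₁') (fun p i => Real.log (B16ZLower.zNorm (SU 2) (gOfRecord₁₃Ax F 2 (theta13OfThm1CCMWZBAx F 2 j γ a₀ ε₀ ε₂₉ B₃ B₉ a₀ a₁' (fun _ _ => 0) (fun _ _ => 0)) p i ^ 2) ε))) (chiFixed29Ax F 2 (numerics7OfThm1CCM F.L j ε₀ B₃ B₉ a₀ a₁')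 ε₂₉) P (k + 1) U ∧
          densOfRecord₁₃Chi F 2 (theta13OfThm1CCMWZBAx F 2 j γ a₀ ε₀ ε₂₉ B₃ B₉ a₀ a₁' (Efl j γ ε₀ ε₂₉ B₃ B₉ a₀ a₁') (fun p i => Real.log (B16ZLower.zNorm (SU 2) (gOfRecord₁₃Ax F 2 (theta13OfThm1CCMWZBAx F 2 j γ a₀ ε₀ ε₂₉ B₃ B₉ a₀ a₁' (fun _ _ => 0) (fun _ _ => 0)) p i ^ 2) ε))) (chiFixed29Ax F 2 (numerics7OfThm1CCM F.L j ε₀ B₃ B₉ a₀ a₁') ε₂₉) P (k + 1) U ≤ Real.exp (ep (gOfRecord₁₃Ax F 2 (theta13OfThm1CCMWZBAx F 2 j γ a₀ ε₀ ε₂₉ B₃ B₉ a₀ a₁' (Efl j γ ε₀ ε₂₉ B₃ B₉ a₀ a₁') (fun p i => Real.log (B16ZLower.zNorm (SU 2) (gOfRecord₁₃Ax F 2 (theta13OfThm1CCMWZBAx F 2 j γ a₀ ε₀ ε₂₉ B₃ B₉ a₀ a₁' (fun _ _ => 0) (fun _ _ => 0)) p i ^ 2) ε))) P (k + 1)) *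 (Fintype.card (Site (F.P P.K) (k + 1)) : ℝ))) := by
    refine ⟨min γ₁₃ (min γR 1), lt_min hγ₁₃ (lt_min hγR one_pos), fun g => max (em g) (4 * max (numerics7OfThm1CCM F.L j ε₀ B₃ B₉ a₀ a₁').logσ₀ 0 + B16ZLower.CzSU 2 ε + CE + 12 * (1 / g) ^ 2), fun g => max (ep g) (4 * ((dimSU 2 : ℕ) : ℝ) * (Real.log g⁻¹ + M / 2) + 4 * max (-(numerics7OfThm1CCM F.L j ε₀ B₃ B₉ a₀ a₁').logσ₀) 0 + CE), ?_, ?_⟩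
    · intro P hI _ U
      -- p643638 writes the Wilson exponent `-(1∕g)²·A`, K1ᴬ's text `-(1∕g²·A)`: one `ring` identity
      have negsq : ∀ g W : ℝ, -(1 / g) ^ 2 * W = -(1 / g ^ 2 * W) := fun g W => by ring
      have h := h0 P hI U
      rw [negsq] at h
      exact mono (chiβOfRecord₁₃Ax_mem_Icc F 2 j γ a₀ ε₀ ε₂₉ B₃ B₉ a₀ a₁' _ _ P.K _ 0 U).1 (Nat.cast_nonneg _) (le_max_right _ _) (le_max_right _ _) h
    · intro P hI k hk hS
      have hI' : ((datumOfRecord₁₃SepCoPHAx F 2 (gaussPinH (Stage13HParams.ofHistoryBlind F 2 ⟨theta13OfThm1CCMWZBAx F 2 j γ a₀ ε₀ ε₂₉ B₃ B₉ a₀ a₁' (Efl j γ ε₀ ε₂₉ B₃ B₉ a₀ a₁') (fun p i => Real.log (B16ZLower.zNorm (SU 2) (gOfRecord₁₃Ax F 2 (theta13OfThm1CCMWZBAx F 2 j γ a₀ ε₀ ε₂₉ B₃ B₉ a₀ a₁' (fun _ _ => 0) (fun _ _ => 0)) p i ^ 2) ε)), ZrOfRecord₁₃Ax F 2 (theta13OfThm1CCMWZBAx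 F 2 j γ a₀ ε₀ ε₂₉ B₃ B₉ a₀ a₁' (Efl j γ ε₀ ε₂₉ B₃ B₉ a₀ a₁') (fun p i => Real.log (B16ZLower.zNorm (SU 2) (gOfRecord₁₃Ax F 2 (theta13OfThm1CCMWZBAx F 2 j γ a₀ ε₀ ε₂₉ B₃ B₉ a₀ a₁' (fun _ _ => 0) (fun _ _ => 0)) p i ^ 2) ε)))⟩) (chiFixed29Ax F 2 (numerics7OfThm1CCM F.L j ε₀ B₃ B₉ a₀ a₁') ε₂₉)) hP).C P).flow.InInterval γ₁₃ P.K := fun i hi => ⟨(hI i hi).1, (hI i hi).2.trans (min_le_left _ _)⟩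
      filter_upwards [hae P hI' k hk hS] with U hU
      exact mono (chiβOfRecord₁₃Ax_mem_Icc F 2 j γ a₀ ε₀ ε₂₉ B₃ B₉ a₀ a₁' _ _ P.K _ (k + 1) U).1 (Nat.cast_nonneg _) (le_max_left _ _) (le_max_left _ _) hU
  obtain ⟨Y₀, h6⟩ := h06F hγpos hγh hε hε' hBpos.le hB9.le ha₀ ha₁' ha₀ρ hε₀def hloZ hupZ hl hu
  -- edition «N09T-Ax»: N09's Theorem-3 MEMBER at the witness DERIVED from its fourteen located input rows (g23's Ax door v2, `γ₉ := 1`)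
  obtain ⟨r1, r2, r3, r4, r5, r6, r7, r8, r9, r10, r11, r12, r13, r14⟩ := h09RF hγpos hγh hε hε' hBpos.le hB9.le ha₀ ha₁' ha₀ρ hε₀def hloZ hupZ hl hu hP _ rfl
  have h9T := h09T_recordAx_of_hierAxial_of_reg8_of_suppPt _ hP r1 r2 r3 r4 r5 r6 r7 r8 r9 r10 r11 r12 r13 r14
  -- ★ LINE 2′ AT THIS WITNESS: rung 1ⱽᵂ's body from the bills (✓p813787 §3; N13 = `h13` just assembled, N12 = `h12F` at the pin), ceiling letter `βup := max β′ (−(−β′))`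
  obtain ⟨v, w, hβup, -, hbody⟩ := N24_rung1VW_bodyAt_of_bills_at_aeRow F
    (gaussPinH (Stage13HParams.ofHistoryBlind F 2 ⟨theta13OfThm1CCMWZBAx F 2 j γ a₀ ε₀ ε₂₉ B₃ B₉ a₀ a₁' (Efl j γ ε₀ ε₂₉ B₃ B₉ a₀ a₁') (fun p i => Real.log (B16ZLower.zNorm (SU 2) (gOfRecord₁₃Ax F 2 (theta13OfThm1CCMWZBAx F 2 j γ a₀ ε₀ ε₂₉ B₃ B₉ a₀ a₁' (fun _ _ => 0) (fun _ _ => 0)) p i ^ 2) ε)), ZrOfRecord₁₃Ax F 2 (theta13OfThm1CCMWZBAx F 2 j γ a₀ ε₀ ε₂₉ B₃ B₉ a₀ a₁' (Efl j γ ε₀ ε₂₉ B₃ B₉ a₀ a₁') (fun p i => Real.log (B16ZLower.zNorm (SU 2) (gOfRecord₁₃Ax F 2 (theta13OfThm1CCMWZBAx F 2 j γ a₀ ε₀ ε₂₉ B₃ B₉ a₀ a₁' (fun _ _ => 0) (fun _ _ => 0)) p i ^ 2) ε)))⟩) (chiFixed29Ax F 2 (numerics7OfThm1CCM F.L j ε₀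 B₃ B₉ a₀ a₁') ε₂₉))
    hP hU hA
    (h05F hγpos hγh hε hε' hBpos.le hB9.le ha₀ ha₁' ha₀ρ hε₀def hloZ hupZ hl hu) ⟨_, h6⟩ h07 h08
    (h09F hγpos hγh hε hε' hBpos.le hB9.le ha₀ ha₁' ha₀ρ hε₀def hloZ hupZ hl hu) h9T
    (h10F hγpos hγh hε hε' hBpos.le hB9.le ha₀ ha₁' ha₀ρ hε₀def hloZ hupZ hl hu)
    (h11Family_gaussPinH_ofHistoryBlind_theta13OfThm1CCMWZB_of_exists_supplier_windowed (j := j) (γ := γ) (εbg := a₀) (ε₀ := ε₀) (ε₂₉ := ε₂₉) (B₃ := B₃) (B₃' := B₉) (a₀ := a₀) (a₁ := a₁') (Efl := (Efl j γ ε₀ ε₂₉ B₃ B₉ a₀ a₁')) (logz := (fun p i => Real.log (B16ZLower.zNorm (SU 2) (gOfRecord₁₃Ax F 2 (theta13OfThm1CCMWZBAx F 2 j γ a₀ ε₀ ε₂₉ B₃ B₉ a₀ a₁' (fun _ _ => 0) (fun _ _ => 0)) p i ^ 2) ε))) (chiFixed29Ax F 2 (numerics7OfThm1CCM F.L j ε₀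 B₃ B₉ a₀ a₁') ε₂₉) hγpos hγh ha₀ hε hε' hBpos.le hB9.le ha₀ ha₁' _ hP hγpos ⟨σ, hσ, hops⟩)
    hlaws (h12F hγpos hγh hε hε' hBpos.le hB9.le ha₀ ha₁' ha₀ρ hε₀def hloZ hupZ hl hu hP) h13 (max β' (-(-β')))
  -- ★ rung 2ⱽᵂ‴ at the KEPT witness: (i) FROM THE BOX with `b := 0`, `r := max β′ (−(−β′))` (n07-w3's `runConstRemainder_zero_of_boxH'`), (ii) `0 ≤ 0`, (iii) by the ceiling letter,
  -- (iv) + (C) NODE O's from the socket, all at the cut level `min γ γ₁` (`survCont_anti`)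
  obtain ⟨_, _, γ₁, M₁, hγ₁, -, hps₁, hsc₁⟩ := hrowsE
  have hW : RunRowsContAtSomeRecord13PWSVW F :=
    N24_runRowsContAtSomeRecord13PWSVW_of_bodyAt_of_rows_of_cont
      (gaussPinH (Stage13HParams.ofHistoryBlind F 2 ⟨theta13OfThm1CCMWZBAx F 2 j γ a₀ ε₀ ε₂₉ B₃ B₉ a₀ a₁' (Efl j γ ε₀ ε₂₉ B₃ B₉ a₀ a₁') (fun p i => Real.log (B16ZLower.zNorm (SU 2) (gOfRecord₁₃Ax F 2 (theta13OfThm1CCMWZBAx F 2 j γ a₀ ε₀ ε₂₉ B₃ B₉ a₀ a₁' (fun _ _ => 0) (fun _ _ => 0)) p i ^ 2) ε)), ZrOfRecord₁₃Ax F 2 (theta13OfThm1CCMWZBAx F 2 j γ a₀ ε₀ ε₂₉ B₃ B₉ a₀ a₁' (Efl j γ ε₀ ε₂₉ B₃ B₉ a₀ a₁') (fun p i => Real.log (B16ZLower.zNorm (SU 2) (gOfRecord₁₃Ax F 2 (theta13OfThm1CCMWZBAx F 2 j γ a₀ ε₀ ε₂₉ B₃ B₉ a₀ a₁' (fun _ _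 => 0) (fun _ _ => 0)) p i ^ 2) ε)))⟩) (chiFixed29Ax F 2 (numerics7OfThm1CCM F.L j ε₀ B₃ B₉ a₀ a₁') ε₂₉))
      hP v w hbody (b := fun _ => 0) (r := max β' (-(-β'))) (γ₀ := min γ γ₁) (B := 0) (M := M₁) (lt_min hγpos hγ₁)
      (runConstRemainder_zero_of_boxH' hloZ hupZ (min_le_left _ _)) (fun _ => le_rfl) (by rw [hβup, zero_add])
      (fun n gs hrg hI k hk => hps₁ n gs hrg (fun i hi => ⟨(hI i hi).1, (hI i hi).2.trans (min_le_right _ _)⟩) k hk)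
      (survCont_anti (lt_min hγpos hγ₁) (min_le_right _ _) hsc₁)
  -- K1ᴬ's body at `F` from rung 2ⱽᵂ‴ (the kit's R1W composition per `F`; = the parent's `k1AxBodyAt_of_runRowsContAtSomeRecord13PWSVW`, inlined)
  obtain ⟨θw, hw, vw, ww, hUw, hθw, hRw, hnodesw, bw, rw, γw, Bw, Mw, hγw', hremw, hBw, hmatchw, hpsw, hscw⟩ := hW
  obtain ⟨hbw, hwinw⟩ := endStatementBPrinted_window_of_recordSV_of_nodesW_of_runLetters hRw hnodesw hγw' hremw hBw hmatchw hpsw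
  exact ⟨θw, hw, vw, hUw, hθw, hbw, hwinw, bw, rw, γw, Mw, hγw', hremw, hpsw, hscw⟩

/-- **★★★★ K1ᴬ `StabilityBRunRowsAtRecordR13SepCoPHVAx` (stmt-QuantumFields-27239) BY ITS ROUTE NAME THROUGH THE REGISTERED LINE 2′ ON THE COFINAL β-SOCKET AT THE Ax GAUSS PIN OF THE PRINTED-z MEMBER (N05 in
S-form, N12's PIN displayed, N09's THEOREM-3 MEMBER DISPLAYED, N13's LEVEL-0 FACE CONSUMED)** — `intro F _; exact §1 …` with every family read at `F`: the cofinal β-socket `hβc` (K0ᴬ ⊕ NODE O at the Ax β), the road-free slot families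
(N05 in S-form `B8LeafOfRecordSubBH`; N12 the rung pin `h12`; N07, N08, N09's Lemma-4 leaf `h09` + Theorem-3 member `h09T`; N10; N06 = the carrier-generic SOCKET `h06`, JUNK-INHABITABLE), N11's χ supplier `h11N`, the `Efl` volume bound, N13's
a.e. rows at levels ≥ 1 — all READ AT the Ax Gauss pin of `theta13OfThm1CCMWZBAx F 2 j γ a₀ ε₀ ε₂₉ B₃ B₃' a₀ a₁ (Efl F j γ …) (fun p i => Real.log (B16ZLower.zNorm (SU 2) (gOfRecord₁₃Ax F 2 (θᴬˣ at zero letters) p i ^ 2) ε))`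
(print's [I] (0.15) normalisation, door-wise) with the cut-off slot at `χ⋆`.  THE K1ᴬ KERNEL SENTENCE ON THE COFINAL SOCKET AT THE RE-CENTRED RECORD.  CONDITIONAL (audit `proof.conditional`); not a
closure; no stub proved or closed; no count moved. [cite: Balaban1989LargeFieldII, Thm 1 p.355, (0.1) pp.355–356, (0.15) p.360, p.391; Balaban1988Convergent, Theorem p.245, Cor. 3 (2.50) p.264, (0.2) p.244, (1.15) p.249, (2.1) p.254, (2.5)–(2.8) pp.255–256, (3.16)–(3.25) pp.268–270, §3 p.279; Balaban1987RG1, (0.1) p.251, (0.14)–(0.17) pp.254–255, (0.20) p.256, Thm 3 p.264, (1.20)–(1.22) p.264, §1 pp.263–264, (2.1)–(2.3) p.265, (2.9)–(2.10) pp.266–267; Balaban1985RegularSpaces, Prop. 7 (1.145) p.100, Thm 8 (1.146) p.101 (bookkeeping); Balaban1985Variational, Thm 1 (6), (8)–(10) p.279 and (181) p.307; Balaban1985Averaging, Prop. 2 (53) p.26] -/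
theorem N24_stabilityBRunRowsAtRecordR13SepCoPHVAx_byName_line2VW_of_cofinalBetaSocketZBV23_of_childrenS_N12Pin_N09RowsAxDoorN11SupplierRowsThm1AEPos_atGaussPinPrintedZB (ε : ℝ) (hεz : 0 < ε)
    (Efl : T4Family → ℕ → ℝ → ℝ → ℝ → ℝ → ℝ → ℝ → ℝ → B12.RunParams → ℕ → ℝ)
    (h05 : ∀ (F : T4Family) {j : ℕ} {γ ε₀ ε₂₉ B₃ B₃' a₀ a₁ : ℝ} (hγ₀ : 0 < γ) (hγh : γ ≤ 1 / 2) (hε : 0 < ε₀) (hε' : 0 < ε₂₉) (hB : 0 ≤ B₃) (hB' : 0 ≤ B₃') (ha₀ : 0 < a₀) (ha₁ : 0 < a₁) (ha₀ρ : a₀ ≤ 1 / (109824 * (F.L : ℝ) ^ 2)) (hε₀ρ : ε₀ = a₀) {bl β' : ℝ} (hbox : BetaLowerH bl γ (betaOfRecord₁₃Ax F 2 (theta13OfThm1CCMWZBAx F 2 j γ a₀ ε₀ ε₂₉ B₃ B₃' a₀ a₁ (Efl F j γ ε₀ ε₂₉ B₃ B₃' a₀ a₁) (fun p i => Real.log (B16ZLower.zNorm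 (SU 2) (gOfRecord₁₃Ax F 2 (theta13OfThm1CCMWZBAx F 2 j γ a₀ ε₀ ε₂₉ B₃ B₃' a₀ a₁ (fun _ _ => 0) (fun _ _ => 0)) p i ^ 2) ε))))) (hbox' : BetaUpperH β' γ (betaOfRecord₁₃Ax F 2 (theta13OfThm1CCMWZBAx F 2 j γ a₀ ε₀ ε₂₉ B₃ B₃' a₀ a₁ (Efl F j γ ε₀ ε₂₉ B₃ B₃' a₀ a₁) (fun p i => Real.log (B16ZLower.zNorm (SU 2) (gOfRecord₁₃Ax F 2 (theta13OfThm1CCMWZBAx F 2 j γ a₀ ε₀ ε₂₉ B₃ B₃' a₀ a₁ (fun _ _ => 0) (fun _ _ => 0)) p i ^ 2) ε))))) (hl : -bl * γ ^ 2 ≤ 3) (hβ' : β' * γ ^ 2 ≤ 3 / 4),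
      ∃ lam8 : ResidB8 (theta13OfThm1CCMWZBAx F 2 j γ a₀ ε₀ ε₂₉ B₃ B₃' a₀ a₁ (Efl F j γ ε₀ ε₂₉ B₃ B₃' a₀ a₁) (fun p i => Real.log (B16ZLower.zNorm (SU 2) (gOfRecord₁₃Ax F 2 (theta13OfThm1CCMWZBAx F 2 j γ a₀ ε₀ ε₂₉ B₃ B₃' a₀ a₁ (fun _ _ => 0) (fun _ _ => 0)) p i ^ 2) ε))).toStage3Params, B8LeafOfRecordSubBH (theta13OfThm1CCMWZBAx F 2 j γ a₀ ε₀ ε₂₉ B₃ B₃' a₀ a₁ (Efl F j γ ε₀ ε₂₉ B₃ B₃' a₀ a₁) (fun p i => Real.log (B16ZLower.zNorm (SU 2) (gOfRecord₁₃Ax F 2 (theta13OfThm1CCMWZBAx F 2 j γ a₀ ε₀ ε₂₉ B₃ B₃' a₀ a₁ (fun _ _ => 0) (fun _ _ => 0)) p i ^ 2) ε))).toStage3Params lam8)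
    (h06 : ∀ (F : T4Family) {j : ℕ} {γ ε₀ ε₂₉ B₃ B₃' a₀ a₁ : ℝ} (hγ₀ : 0 < γ) (hγh : γ ≤ 1 / 2) (hε : 0 < ε₀) (hε' : 0 < ε₂₉) (hB : 0 ≤ B₃) (hB' : 0 ≤ B₃') (ha₀ : 0 < a₀) (ha₁ : 0 < a₁) (ha₀ρ : a₀ ≤ 1 / (109824 * (F.L : ℝ) ^ 2)) (hε₀ρ : ε₀ = a₀) {bl β' : ℝ} (hbox : BetaLowerH bl γ (betaOfRecord₁₃Ax F 2 (theta13OfThm1CCMWZBAx F 2 j γ a₀ ε₀ ε₂₉ B₃ B₃' a₀ a₁ (Efl F j γ ε₀ ε₂₉ B₃ B₃' a₀ a₁) (fun p i => Real.log (B16ZLower.zNorm (SU 2) (gOfRecord₁₃Ax F 2 (theta13OfThm1CCMWZBAx F 2 j γ a₀ ε₀ ε₂₉ B₃ B₃' a₀ a₁ (fun _ _ => 0) (fun _ _ => 0)) p i ^ 2) ε))))) (hbox' : BetaUpperH β' γ (betaOfRecord₁₃Ax F 2 (theta13OfThm1CCMWZBAx F 2 j γ a₀ ε₀ ε₂₉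 B₃ B₃' a₀ a₁ (Efl F j γ ε₀ ε₂₉ B₃ B₃' a₀ a₁) (fun p i => Real.log (B16ZLower.zNorm (SU 2) (gOfRecord₁₃Ax F 2 (theta13OfThm1CCMWZBAx F 2 j γ a₀ ε₀ ε₂₉ B₃ B₃' a₀ a₁ (fun _ _ => 0) (fun _ _ => 0)) p i ^ 2) ε))))) (hl : -bl * γ ^ 2 ≤ 3) (hβ' : β' * γ ^ 2 ≤ 3 / 4),
      ∃ Y₀ : PrintedCarriers9X, B9LeafX Y₀)
    (h07 : ∀ F : T4Family, ∃ ζ : ResidZ F 2, B11Leaf (Z11OfRecord F 2 ζ))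
    (h08 : ∀ F : T4Family, PrintedUV3V 2 F.L)
    (h09 : ∀ (F : T4Family) {j : ℕ} {γ ε₀ ε₂₉ B₃ B₃' a₀ a₁ : ℝ} (hγ₀ : 0 < γ) (hγh : γ ≤ 1 / 2) (hε : 0 < ε₀) (hε' : 0 < ε₂₉) (hB : 0 ≤ B₃) (hB' : 0 ≤ B₃') (ha₀ : 0 < a₀) (ha₁ : 0 < a₁) (ha₀ρ : a₀ ≤ 1 / (109824 * (F.L : ℝ) ^ 2)) (hε₀ρ : ε₀ = a₀) {bl β' : ℝ} (hbox : BetaLowerH bl γ (betaOfRecord₁₃Ax F 2 (theta13OfThm1CCMWZBAx F 2 j γ a₀ ε₀ ε₂₉ B₃ B₃' a₀ a₁ (Efl F j γ ε₀ ε₂₉ B₃ B₃' a₀ a₁) (fun p i => Real.log (B16ZLower.zNorm (SU 2) (gOfRecord₁₃Ax F 2 (theta13OfThm1CCMWZBAx F 2 j γ a₀ ε₀ ε₂₉ B₃ B₃' a₀ a₁ (fun _ _ => 0) (fun _ _ => 0)) p i ^ 2) ε))))) (hbox' : BetaUpperH β' γ (betaOfRecord₁₃Ax F 2 (theta13OfThm1CCMWZBAx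 F 2 j γ a₀ ε₀ ε₂₉ B₃ B₃' a₀ a₁ (Efl F j γ ε₀ ε₂₉ B₃ B₃' a₀ a₁) (fun p i => Real.log (B16ZLower.zNorm (SU 2) (gOfRecord₁₃Ax F 2 (theta13OfThm1CCMWZBAx F 2 j γ a₀ ε₀ ε₂₉ B₃ B₃' a₀ a₁ (fun _ _ => 0) (fun _ _ => 0)) p i ^ 2) ε))))) (hl : -bl * γ ^ 2 ≤ 3) (hβ' : β' * γ ^ 2 ≤ 3 / 4),
      ∃ lam12 : ResidB12 F 2 (theta13OfThm1CCMWZBAx F 2 j γ a₀ ε₀ ε₂₉ B₃ B₃' a₀ a₁ (Efl F j γ ε₀ ε₂₉ B₃ B₃' a₀ a₁) (fun p i => Real.log (B16ZLower.zNorm (SU 2) (gOfRecord₁₃Ax F 2 (theta13OfThm1CCMWZBAx F 2 j γ a₀ ε₀ ε₂₉ B₃ B₃' a₀ a₁ (fun _ _ => 0) (fun _ _ => 0)) p i ^ 2) ε))).τ9.M,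
      ∀ P : B12.RunParams, B12Sec2to5.Lemma4Printed (F12OfRecord₁₂ F 2 (theta13OfThm1CCMWZBAx F 2 j γ a₀ ε₀ ε₂₉ B₃ B₃' a₀ a₁ (Efl F j γ ε₀ ε₂₉ B₃ B₃' a₀ a₁) (fun p i => Real.log (B16ZLower.zNorm (SU 2) (gOfRecord₁₃Ax F 2 (theta13OfThm1CCMWZBAx F 2 j γ a₀ ε₀ ε₂₉ B₃ B₃' a₀ a₁ (fun _ _ => 0) (fun _ _ => 0)) p i ^ 2) ε))).toStage12Params lam12 P) (lam12 P).consts)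
    (h09R : ∀ (F : T4Family) {j : ℕ} {γ ε₀ ε₂₉ B₃ B₃' a₀ a₁ : ℝ} (hγ₀ : 0 < γ) (hγh : γ ≤ 1 / 2) (hε : 0 < ε₀) (hε' : 0 < ε₂₉) (hB : 0 ≤ B₃) (hB' : 0 ≤ B₃') (ha₀ : 0 < a₀) (ha₁ : 0 < a₁) (ha₀ρ : a₀ ≤ 1 / (109824 * (F.L : ℝ) ^ 2)) (hε₀ρ : ε₀ = a₀) {bl β' : ℝ} (hbox : BetaLowerH bl γ (betaOfRecord₁₃Ax F 2 (theta13OfThm1CCMWZBAx F 2 j γ a₀ ε₀ ε₂₉ B₃ B₃' a₀ a₁ (Efl F j γ ε₀ ε₂₉ B₃ B₃' a₀ a₁) (fun p i => Real.log (B16ZLower.zNorm (SU 2) (gOfRecord₁₃Ax F 2 (theta13OfThm1CCMWZBAx F 2 j γ a₀ ε₀ ε₂₉ B₃ B₃' a₀ a₁ (fun _ _ => 0) (fun _ _ => 0)) p i ^ 2) ε))))) (hbox' : BetaUpperH β' γ (betaOfRecord₁₃Ax F 2 (theta13OfThm1CCMWZBAx F 2 j γ a₀ ε₀ ε₂₉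 B₃ B₃' a₀ a₁ (Efl F j γ ε₀ ε₂₉ B₃ B₃' a₀ a₁) (fun p i => Real.log (B16ZLower.zNorm (SU 2) (gOfRecord₁₃Ax F 2 (theta13OfThm1CCMWZBAx F 2 j γ a₀ ε₀ ε₂₉ B₃ B₃' a₀ a₁ (fun _ _ => 0) (fun _ _ => 0)) p i ^ 2) ε))))) (hl : -bl * γ ^ 2 ≤ 3) (hβ' : β' * γ ^ 2 ≤ 3 / 4)
      (hP : (gaussPinH (Stage13HParams.ofHistoryBlind F 2 ⟨theta13OfThm1CCMWZBAx F 2 j γ a₀ ε₀ ε₂₉ B₃ B₃' a₀ a₁ (Efl F j γ ε₀ ε₂₉ B₃ B₃' a₀ a₁) (fun p i => Real.log (B16ZLower.zNorm (SU 2) (gOfRecord₁₃Ax F 2 (theta13OfThm1CCMWZBAx F 2 j γ a₀ ε₀ ε₂₉ B₃ B₃' a₀ a₁ (fun _ _ => 0) (fun _ _ => 0)) p i ^ 2) ε)), ZrOfRecord₁₃Ax F 2 (theta13OfThm1CCMWZBAx F 2 j γ a₀ ε₀ ε₂₉ B₃ B₃' a₀ a₁ (Efl F j γ ε₀ ε₂₉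 B₃ B₃' a₀ a₁) (fun p i => Real.log (B16ZLower.zNorm (SU 2) (gOfRecord₁₃Ax F 2 (theta13OfThm1CCMWZBAx F 2 j γ a₀ ε₀ ε₂₉ B₃ B₃' a₀ a₁ (fun _ _ => 0) (fun _ _ => 0)) p i ^ 2) ε)))⟩) (chiFixed29Ax F 2 (numerics7OfThm1CCM F.L j ε₀ B₃ B₃' a₀ a₁) ε₂₉)).Provisos₁₃SepCoPHAx F 2),
      ∀ (θN : Stage13HParams F 2), θN = (gaussPinH (Stage13HParams.ofHistoryBlind F 2 ⟨theta13OfThm1CCMWZBAx F 2 j γ a₀ ε₀ ε₂₉ B₃ B₃' a₀ a₁ (Efl F j γ ε₀ ε₂₉ B₃ B₃' a₀ a₁) (fun p i => Real.log (B16ZLower.zNorm (SU 2) (gOfRecord₁₃Ax F 2 (theta13OfThm1CCMWZBAx F 2 j γ a₀ ε₀ ε₂₉ B₃ B₃' a₀ a₁ (fun _ _ => 0) (fun _ _ => 0)) p i ^ 2) ε)), ZrOfRecord₁₃Ax F 2 (theta13OfThm1CCMWZBAx F 2 j γ a₀ ε₀ ε₂₉ B₃ B₃' a₀ a₁ (Efl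 F j γ ε₀ ε₂₉ B₃ B₃' a₀ a₁) (fun p i => Real.log (B16ZLower.zNorm (SU 2) (gOfRecord₁₃Ax F 2 (theta13OfThm1CCMWZBAx F 2 j γ a₀ ε₀ ε₂₉ B₃ B₃' a₀ a₁ (fun _ _ => 0) (fun _ _ => 0)) p i ^ 2) ε)))⟩) (chiFixed29Ax F 2 (numerics7OfThm1CCM F.L j ε₀ B₃ B₃' a₀ a₁) ε₂₉)) →
      (∀ (P : B12.RunParams) (k : ℕ), k ≤ P.K → ∀ V ∈ domAltOfRecord F 2 θN.ν P.K k, Uk F 2 P.K k θN.εbg V ∈ bgReg F 2 P.K k θN.ν.εreg) ∧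
        (θN.ν.εreg ≤ θN.εbg) ∧
        (0 ≤ θN.ν.εreg) ∧
        (∀ (P : B12.RunParams) (k : ℕ), k ≤ P.K → ∀ V ∈ domAltOfRecord F 2 θN.ν P.K k, ∀ j < k,
      AxialGauge (contourOfRecord F 2 P.K j) (Averaging.iter (avOfRecord F 2 P.K) j (Uk F 2 P.K k θN.εbg V))) ∧
        (∀ (P : B12.RunParams) (i : ℕ), i + 1 < P.K → ∀ U : GaugeField (F.P P.K) (i + 1) (SU 2),
      (avOfRecord F 2 P.K (i + 1)).avg U ∈ domAltOfRecord F 2 θN.ν P.K (i + 2) →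
        U ∉ regSetOfRecord F 2 P.K i (betaInputOfRecord F 2 (TβOfRecord₁₃ F 2) (chiβOfRecord₁₃Ax F 2 θN.toStage13Params) P.K (gOfRecord₁₃Ax F 2 θN.toStage13Params P) i) ∩
            domAltOfRecord F 2 θN.ν P.K (i + 1) →
          chiβOfRecord₁₃Ax F 2 θN.toStage13Params P.K (gOfRecord₁₃Ax F 2 θN.toStage13Params P) (i + 1) U = 0) ∧
        (∀ (P : B12.RunParams), ∀ j < P.K, Integrable (betaInputOfRecord F 2 (TβOfRecord₁₃ F 2) (chiβOfRecord₁₃Ax F 2 θN.toStage13Params) P.K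
      (gOfRecord₁₃Ax F 2 θN.toStage13Params P) j) (fieldMeasure (F.P P.K) j (SU 2))) ∧
        (∀ (P : B12.RunParams) (k : ℕ), k ≤ P.K → ∀ V ∈ domAltOfRecord F 2 θN.ν P.K k, UkExists F 2 P.K k θN.εbg V ∧ UniqueUkOrbit F 2 P.K k θN.εbg V) ∧
        (∀ (P : B12.RunParams) (k : ℕ), k ≤ P.K → HRestrict F 2 θN.εbg P.K k (domAltOfRecord F 2 θN.ν P.K k)) ∧
        (∀ (P : B12.RunParams) (k : ℕ), k ≤ P.K → ∀ V ∈ domAltOfRecord F 2 θN.ν P.K k, ∀ j < k,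
      UniqueUkOrbit F 2 P.K (j + 1) θN.εbg (Averaging.iter (avOfRecord F 2 P.K) (j + 1) (Uk F 2 P.K k θN.εbg V))) ∧
        (0 < θN.ε₂₉) ∧
        (0 < θN.εbg) ∧
        (∀ P : B12.RunParams, (143 * (((((F.P P.K).d + 4 : ℕ) : ℝ)) ^ 2 / 4) ^ 2) * θN.εbg ≤ 1 / 3) ∧
        (∀ P : B12.RunParams, 2 * θN.εbg ≤ 2 * deltaSU (Fin 2) / ((((F.P P.K).d + 4) * (F.P P.K).L : ℕ) : ℝ) ^ 2) ∧
        (∀ P : B12.RunParams, 2 * θN.εbg ≤ θN.ν.ε₀ * ((F.P P.K).L : ℝ) ^ 2))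
    (h10 : ∀ (F : T4Family) {j : ℕ} {γ ε₀ ε₂₉ B₃ B₃' a₀ a₁ : ℝ} (hγ₀ : 0 < γ) (hγh : γ ≤ 1 / 2) (hε : 0 < ε₀) (hε' : 0 < ε₂₉) (hB : 0 ≤ B₃) (hB' : 0 ≤ B₃') (ha₀ : 0 < a₀) (ha₁ : 0 < a₁) (ha₀ρ : a₀ ≤ 1 / (109824 * (F.L : ℝ) ^ 2)) (hε₀ρ : ε₀ = a₀) {bl β' : ℝ} (hbox : BetaLowerH bl γ (betaOfRecord₁₃Ax F 2 (theta13OfThm1CCMWZBAx F 2 j γ a₀ ε₀ ε₂₉ B₃ B₃' a₀ a₁ (Efl F j γ ε₀ ε₂₉ B₃ B₃' a₀ a₁) (fun p i => Real.log (B16ZLower.zNorm (SU 2) (gOfRecord₁₃Ax F 2 (theta13OfThm1CCMWZBAx F 2 j γ a₀ ε₀ ε₂₉ B₃ B₃' a₀ a₁ (fun _ _ => 0) (fun _ _ => 0)) p i ^ 2) ε))))) (hbox' : BetaUpperH β' γ (betaOfRecord₁₃Ax F 2 (theta13OfThm1CCMWZBAx F 2 j γ a₀ ε₀ ε₂₉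 B₃ B₃' a₀ a₁ (Efl F j γ ε₀ ε₂₉ B₃ B₃' a₀ a₁) (fun p i => Real.log (B16ZLower.zNorm (SU 2) (gOfRecord₁₃Ax F 2 (theta13OfThm1CCMWZBAx F 2 j γ a₀ ε₀ ε₂₉ B₃ B₃' a₀ a₁ (fun _ _ => 0) (fun _ _ => 0)) p i ^ 2) ε))))) (hl : -bl * γ ^ 2 ≤ 3) (hβ' : β' * γ ^ 2 ≤ 3 / 4),
      ∃ lam13 : B12.RunParams → ResidB13 (theta13OfThm1CCMWZBAx F 2 j γ a₀ ε₀ ε₂₉ B₃ B₃' a₀ a₁ (Efl F j γ ε₀ ε₂₉ B₃ B₃' a₀ a₁) (fun p i => Real.log (B16ZLower.zNorm (SU 2) (gOfRecord₁₃Ax F 2 (theta13OfThm1CCMWZBAx F 2 j γ a₀ ε₀ ε₂₉ B₃ B₃' a₀ a₁ (fun _ _ => 0) (fun _ _ => 0)) p i ^ 2) ε))).toStage3Params,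
      ∀ P : B12.RunParams, B13LeafOfRecord (theta13OfThm1CCMWZBAx F 2 j γ a₀ ε₀ ε₂₉ B₃ B₃' a₀ a₁ (Efl F j γ ε₀ ε₂₉ B₃ B₃' a₀ a₁) (fun p i => Real.log (B16ZLower.zNorm (SU 2) (gOfRecord₁₃Ax F 2 (theta13OfThm1CCMWZBAx F 2 j γ a₀ ε₀ ε₂₉ B₃ B₃' a₀ a₁ (fun _ _ => 0) (fun _ _ => 0)) p i ^ 2) ε))).toStage3Params (lam13 P))
    (h11N : ∀ (F : T4Family) {j : ℕ} {γ ε₀ ε₂₉ B₃ B₃' a₀ a₁ : ℝ} (hγ₀ : 0 < γ) (hγh : γ ≤ 1 / 2) (hε : 0 < ε₀) (hε' : 0 < ε₂₉) (hB : 0 ≤ B₃) (hB' : 0 ≤ B₃') (ha₀ : 0 < a₀) (ha₁ : 0 < a₁) (ha₀ρ : a₀ ≤ 1 / (109824 * (F.L : ℝ) ^ 2)) (hε₀ρ : ε₀ = a₀) {bl β' : ℝ} (hbox : BetaLowerH bl γ (betaOfRecord₁₃Ax F 2 (theta13OfThm1CCMWZBAx F 2 j γ a₀ ε₀ ε₂₉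 B₃ B₃' a₀ a₁ (Efl F j γ ε₀ ε₂₉ B₃ B₃' a₀ a₁) (fun p i => Real.log (B16ZLower.zNorm (SU 2) (gOfRecord₁₃Ax F 2 (theta13OfThm1CCMWZBAx F 2 j γ a₀ ε₀ ε₂₉ B₃ B₃' a₀ a₁ (fun _ _ => 0) (fun _ _ => 0)) p i ^ 2) ε))))) (hbox' : BetaUpperH β' γ (betaOfRecord₁₃Ax F 2 (theta13OfThm1CCMWZBAx F 2 j γ a₀ ε₀ ε₂₉ B₃ B₃' a₀ a₁ (Efl F j γ ε₀ ε₂₉ B₃ B₃' a₀ a₁) (fun p i => Real.log (B16ZLower.zNorm (SU 2) (gOfRecord₁₃Ax F 2 (theta13OfThm1CCMWZBAx F 2 j γ a₀ ε₀ ε₂₉ B₃ B₃' a₀ a₁ (fun _ _ => 0) (fun _ _ => 0)) p i ^ 2) ε))))) (hl : -bl * γ ^ 2 ≤ 3) (hβ' : β' * γ ^ 2 ≤ 3 / 4),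
      ∃ σ : (P : B12.RunParams) → Sect3Supplier (gaussPinH (Stage13HParams.ofHistoryBlind F 2 ⟨theta13OfThm1CCMWZBAx F 2 j γ a₀ ε₀ ε₂₉ B₃ B₃' a₀ a₁ (Efl F j γ ε₀ ε₂₉ B₃ B₃' a₀ a₁) (fun p i => Real.log (B16ZLower.zNorm (SU 2) (gOfRecord₁₃Ax F 2 (theta13OfThm1CCMWZBAx F 2 j γ a₀ ε₀ ε₂₉ B₃ B₃' a₀ a₁ (fun _ _ => 0) (fun _ _ => 0)) p i ^ 2) ε)), ZrOfRecord₁₃Ax F 2 (theta13OfThm1CCMWZBAx F 2 j γ a₀ ε₀ ε₂₉ B₃ B₃' a₀ a₁ (Efl F j γ ε₀ ε₂₉ B₃ B₃' a₀ a₁) (fun p i => Real.log (B16ZLower.zNorm (SU 2) (gOfRecord₁₃Ax F 2 (theta13OfThm1CCMWZBAx F 2 j γ a₀ ε₀ ε₂₉ B₃ B₃' a₀ a₁ (fun _ _ => 0) (fun _ _ => 0)) p i ^ 2) ε)))⟩) (chiFixed29Ax F 2 (numerics7OfThm1CCM F.L j ε₀ B₃ B₃' a₀ a₁) ε₂₉))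 (chiFixed29Ax F 2 (numerics7OfThm1CCM F.L j ε₀ B₃ B₃' a₀ a₁) ε₂₉) P,
        (∀ P : B12.RunParams, Step.InInterval γ P.K (gOfRecord₁₃Ax F 2 (theta13OfThm1CCMWZBAx F 2 j γ a₀ ε₀ ε₂₉ B₃ B₃' a₀ a₁ (Efl F j γ ε₀ ε₂₉ B₃ B₃' a₀ a₁) (fun p i => Real.log (B16ZLower.zNorm (SU 2) (gOfRecord₁₃Ax F 2 (theta13OfThm1CCMWZBAx F 2 j γ a₀ ε₀ ε₂₉ B₃ B₃' a₀ a₁ (fun _ _ => 0) (fun _ _ => 0)) p i ^ 2) ε))) P) → SupplierObligations (gaussPinH (Stage13HParams.ofHistoryBlind F 2 ⟨theta13OfThm1CCMWZBAx F 2 j γ a₀ ε₀ ε₂₉ B₃ B₃' a₀ a₁ (Efl F j γ ε₀ ε₂₉ B₃ B₃' a₀ a₁) (fun p i => Real.log (B16ZLower.zNorm (SU 2) (gOfRecord₁₃Ax F 2 (theta13OfThm1CCMWZBAx F 2 j γ a₀ ε₀ ε₂₉ B₃ B₃' a₀ a₁ (fun _ _ => 0) (fun _ _ => 0)) p i ^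 2) ε)), ZrOfRecord₁₃Ax F 2 (theta13OfThm1CCMWZBAx F 2 j γ a₀ ε₀ ε₂₉ B₃ B₃' a₀ a₁ (Efl F j γ ε₀ ε₂₉ B₃ B₃' a₀ a₁) (fun p i => Real.log (B16ZLower.zNorm (SU 2) (gOfRecord₁₃Ax F 2 (theta13OfThm1CCMWZBAx F 2 j γ a₀ ε₀ ε₂₉ B₃ B₃' a₀ a₁ (fun _ _ => 0) (fun _ _ => 0)) p i ^ 2) ε)))⟩) (chiFixed29Ax F 2 (numerics7OfThm1CCM F.L j ε₀ B₃ B₃' a₀ a₁) ε₂₉)) (chiFixed29Ax F 2 (numerics7OfThm1CCM F.L j ε₀ B₃ B₃' a₀ a₁) ε₂₉) P (σ P)) ∧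
        (∀ P : B12.RunParams, Step.InInterval γ P.K (gOfRecord₁₃Ax F 2 (theta13OfThm1CCMWZBAx F 2 j γ a₀ ε₀ ε₂₉ B₃ B₃' a₀ a₁ (Efl F j γ ε₀ ε₂₉ B₃ B₃' a₀ a₁) (fun p i => Real.log (B16ZLower.zNorm (SU 2) (gOfRecord₁₃Ax F 2 (theta13OfThm1CCMWZBAx F 2 j γ a₀ ε₀ ε₂₉ B₃ B₃' a₀ a₁ (fun _ _ => 0) (fun _ _ => 0)) p i ^ 2) ε))) P) → OperandRowsAlongChain (gaussPinH (Stage13HParams.ofHistoryBlind F 2 ⟨theta13OfThm1CCMWZBAx F 2 j γ a₀ ε₀ ε₂₉ B₃ B₃' a₀ a₁ (Efl F j γ ε₀ ε₂₉ B₃ B₃' a₀ a₁) (fun p i => Real.log (B16ZLower.zNorm (SU 2) (gOfRecord₁₃Ax F 2 (theta13OfThm1CCMWZBAx F 2 j γ a₀ ε₀ ε₂₉ B₃ B₃' a₀ a₁ (fun _ _ => 0) (fun _ _ => 0)) p i ^ 2) ε)), ZrOfRecord₁₃Ax F 2 (theta13OfThm1CCMWZBAx F 2 j γ a₀ ε₀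 ε₂₉ B₃ B₃' a₀ a₁ (Efl F j γ ε₀ ε₂₉ B₃ B₃' a₀ a₁) (fun p i => Real.log (B16ZLower.zNorm (SU 2) (gOfRecord₁₃Ax F 2 (theta13OfThm1CCMWZBAx F 2 j γ a₀ ε₀ ε₂₉ B₃ B₃' a₀ a₁ (fun _ _ => 0) (fun _ _ => 0)) p i ^ 2) ε)))⟩) (chiFixed29Ax F 2 (numerics7OfThm1CCM F.L j ε₀ B₃ B₃' a₀ a₁) ε₂₉)) (chiFixed29Ax F 2 (numerics7OfThm1CCM F.L j ε₀ B₃ B₃' a₀ a₁) ε₂₉) P (σ P)))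
    (h12 : ∀ (F : T4Family) {j : ℕ} {γ ε₀ ε₂₉ B₃ B₃' a₀ a₁ : ℝ} (hγ₀ : 0 < γ) (hγh : γ ≤ 1 / 2) (hε : 0 < ε₀) (hε' : 0 < ε₂₉) (hB : 0 ≤ B₃) (hB' : 0 ≤ B₃') (ha₀ : 0 < a₀) (ha₁ : 0 < a₁) (ha₀ρ : a₀ ≤ 1 / (109824 * (F.L : ℝ) ^ 2)) (hε₀ρ : ε₀ = a₀) {bl β' : ℝ} (hbox : BetaLowerH bl γ (betaOfRecord₁₃Ax F 2 (theta13OfThm1CCMWZBAx F 2 j γ a₀ ε₀ ε₂₉ B₃ B₃' a₀ a₁ (Efl F j γ ε₀ ε₂₉ B₃ B₃' a₀ a₁) (fun p i => Real.log (B16ZLower.zNorm (SU 2) (gOfRecord₁₃Ax F 2 (theta13OfThm1CCMWZBAx F 2 j γ a₀ ε₀ ε₂₉ B₃ B₃' a₀ a₁ (fun _ _ => 0) (fun _ _ => 0)) p i ^ 2) ε))))) (hbox' : BetaUpperH β' γ (betaOfRecord₁₃Ax F 2 (theta13OfThm1CCMWZBAx F 2 j γ a₀ ε₀ ε₂₉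 B₃ B₃' a₀ a₁ (Efl F j γ ε₀ ε₂₉ B₃ B₃' a₀ a₁) (fun p i => Real.log (B16ZLower.zNorm (SU 2) (gOfRecord₁₃Ax F 2 (theta13OfThm1CCMWZBAx F 2 j γ a₀ ε₀ ε₂₉ B₃ B₃' a₀ a₁ (fun _ _ => 0) (fun _ _ => 0)) p i ^ 2) ε))))) (hl : -bl * γ ^ 2 ≤ 3) (hβ' : β' * γ ^ 2 ≤ 3 / 4)
      (hP : (gaussPinH (Stage13HParams.ofHistoryBlind F 2 ⟨theta13OfThm1CCMWZBAx F 2 j γ a₀ ε₀ ε₂₉ B₃ B₃' a₀ a₁ (Efl F j γ ε₀ ε₂₉ B₃ B₃' a₀ a₁) (fun p i => Real.log (B16ZLower.zNorm (SU 2) (gOfRecord₁₃Ax F 2 (theta13OfThm1CCMWZBAx F 2 j γ a₀ ε₀ ε₂₉ B₃ B₃' a₀ a₁ (fun _ _ => 0) (fun _ _ => 0)) p i ^ 2) ε)), ZrOfRecord₁₃Ax F 2 (theta13OfThm1CCMWZBAx F 2 j γ a₀ ε₀ ε₂₉ B₃ B₃' a₀ a₁ (Efl F j γ ε₀ ε₂₉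 B₃ B₃' a₀ a₁) (fun p i => Real.log (B16ZLower.zNorm (SU 2) (gOfRecord₁₃Ax F 2 (theta13OfThm1CCMWZBAx F 2 j γ a₀ ε₀ ε₂₉ B₃ B₃' a₀ a₁ (fun _ _ => 0) (fun _ _ => 0)) p i ^ 2) ε)))⟩) (chiFixed29Ax F 2 (numerics7OfThm1CCM F.L j ε₀ B₃ B₃' a₀ a₁) ε₂₉)).Provisos₁₃SepCoPHAx F 2),
      ∃ (lamW : ResidW F 2) (γ₁₂ : ℝ), 0 < γ₁₂ ∧ (∀ P : B12.RunParams, 1 ≤ P.K → lamW.kSel P < P.K) ∧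
        ∀ P : B12.RunParams, lamW.kSel P < P.K → Step.InInterval γ₁₂ P.K (gOfRecord₁₃Ax F 2 (gaussPinH (Stage13HParams.ofHistoryBlind F 2 ⟨theta13OfThm1CCMWZBAx F 2 j γ a₀ ε₀ ε₂₉ B₃ B₃' a₀ a₁ (Efl F j γ ε₀ ε₂₉ B₃ B₃' a₀ a₁) (fun p i => Real.log (B16ZLower.zNorm (SU 2) (gOfRecord₁₃Ax F 2 (theta13OfThm1CCMWZBAx F 2 j γ a₀ ε₀ ε₂₉ B₃ B₃' a₀ a₁ (fun _ _ => 0) (fun _ _ => 0)) p i ^ 2) ε)), ZrOfRecord₁₃Ax F 2 (theta13OfThm1CCMWZBAx F 2 j γ a₀ ε₀ ε₂₉ B₃ B₃' a₀ a₁ (Efl F j γ ε₀ ε₂₉ B₃ B₃' a₀ a₁) (fun p i => Real.log (B16ZLower.zNorm (SU 2) (gOfRecord₁₃Ax F 2 (theta13OfThm1CCMWZBAx F 2 j γ a₀ ε₀ ε₂₉ B₃ B₃' a₀ a₁ (fun _ _ => 0) (fun _ _ => 0)) p i ^ 2) ε)))⟩) (chiFixed29Ax F 2 (numerics7OfThm1CCM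 F.L j ε₀ B₃ B₃' a₀ a₁) ε₂₉)).toStage13Params P) →
          B15Leaf (WOfRecord₁₃Ax F 2 (gaussPinH (Stage13HParams.ofHistoryBlind F 2 ⟨theta13OfThm1CCMWZBAx F 2 j γ a₀ ε₀ ε₂₉ B₃ B₃' a₀ a₁ (Efl F j γ ε₀ ε₂₉ B₃ B₃' a₀ a₁) (fun p i => Real.log (B16ZLower.zNorm (SU 2) (gOfRecord₁₃Ax F 2 (theta13OfThm1CCMWZBAx F 2 j γ a₀ ε₀ ε₂₉ B₃ B₃' a₀ a₁ (fun _ _ => 0) (fun _ _ => 0)) p i ^ 2) ε)), ZrOfRecord₁₃Ax F 2 (theta13OfThm1CCMWZBAx F 2 j γ a₀ ε₀ ε₂₉ B₃ B₃' a₀ a₁ (Efl F j γ ε₀ ε₂₉ B₃ B₃' a₀ a₁) (fun p i => Real.log (B16ZLower.zNorm (SU 2) (gOfRecord₁₃Ax F 2 (theta13OfThm1CCMWZBAx F 2 j γ a₀ ε₀ ε₂₉ B₃ B₃' a₀ a₁ (fun _ _ => 0) (fun _ _ => 0)) p i ^ 2) ε)))⟩) (chiFixed29Ax F 2 (numerics7OfThm1CCM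 F.L j ε₀ B₃ B₃' a₀ a₁) ε₂₉)).toStage13Params lamW P))
    (hEfl : ∀ (F : T4Family) (j : ℕ) (γ ε₀ ε₂₉ B₃ B₃' a₀ a₁ : ℝ), ∃ CE : ℝ, 0 ≤ CE ∧ ∀ (P : B12.RunParams) (i : ℕ), i < P.K → |Efl F j γ ε₀ ε₂₉ B₃ B₃' a₀ a₁ P i| ≤ CE * sitesCard (F.P P.K) (i + 1))
    (h13pos : ∀ (F : T4Family) {j : ℕ} {γ ε₀ ε₂₉ B₃ B₃' a₀ a₁ : ℝ} (hγ₀ : 0 < γ) (hγh : γ ≤ 1 / 2) (hε : 0 < ε₀) (hε' : 0 < ε₂₉) (hB : 0 ≤ B₃) (hB' : 0 ≤ B₃') (ha₀ : 0 < a₀) (ha₁ : 0 < a₁) (ha₀ρ : a₀ ≤ 1 / (109824 * (F.L : ℝ) ^ 2)) (hε₀ρ : ε₀ = a₀) {bl β' : ℝ} (hbox : BetaLowerH bl γ (betaOfRecord₁₃Ax F 2 (theta13OfThm1CCMWZBAx F 2 j γ a₀ ε₀ ε₂₉ B₃ B₃' a₀ a₁ (Efl F j γ ε₀ ε₂₉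 B₃ B₃' a₀ a₁) (fun p i => Real.log (B16ZLower.zNorm (SU 2) (gOfRecord₁₃Ax F 2 (theta13OfThm1CCMWZBAx F 2 j γ a₀ ε₀ ε₂₉ B₃ B₃' a₀ a₁ (fun _ _ => 0) (fun _ _ => 0)) p i ^ 2) ε))))) (hbox' : BetaUpperH β' γ (betaOfRecord₁₃Ax F 2 (theta13OfThm1CCMWZBAx F 2 j γ a₀ ε₀ ε₂₉ B₃ B₃' a₀ a₁ (Efl F j γ ε₀ ε₂₉ B₃ B₃' a₀ a₁) (fun p i => Real.log (B16ZLower.zNorm (SU 2) (gOfRecord₁₃Ax F 2 (theta13OfThm1CCMWZBAx F 2 j γ a₀ ε₀ ε₂₉ B₃ B₃' a₀ a₁ (fun _ _ => 0) (fun _ _ => 0)) p i ^ 2) ε))))) (hl : -bl * γ ^ 2 ≤ 3) (hβ' : β' * γ ^ 2 ≤ 3 / 4)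
      (hP : (gaussPinH (Stage13HParams.ofHistoryBlind F 2 ⟨theta13OfThm1CCMWZBAx F 2 j γ a₀ ε₀ ε₂₉ B₃ B₃' a₀ a₁ (Efl F j γ ε₀ ε₂₉ B₃ B₃' a₀ a₁) (fun p i => Real.log (B16ZLower.zNorm (SU 2) (gOfRecord₁₃Ax F 2 (theta13OfThm1CCMWZBAx F 2 j γ a₀ ε₀ ε₂₉ B₃ B₃' a₀ a₁ (fun _ _ => 0) (fun _ _ => 0)) p i ^ 2) ε)), ZrOfRecord₁₃Ax F 2 (theta13OfThm1CCMWZBAx F 2 j γ a₀ ε₀ ε₂₉ B₃ B₃' a₀ a₁ (Efl F j γ ε₀ ε₂₉ B₃ B₃' a₀ a₁) (fun p i => Real.log (B16ZLower.zNorm (SU 2) (gOfRecord₁₃Ax F 2 (theta13OfThm1CCMWZBAx F 2 j γ a₀ ε₀ ε₂₉ B₃ B₃' a₀ a₁ (fun _ _ => 0) (fun _ _ => 0)) p i ^ 2) ε)))⟩) (chiFixed29Ax F 2 (numerics7OfThm1CCM F.L j ε₀ B₃ B₃' a₀ a₁) ε₂₉)).Provisos₁₃SepCoPHAx F 2),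
      ∃ γ₁₃ : ℝ, 0 < γ₁₃ ∧ ∃ em ep : ℝ → ℝ,
        (∀ P : B12.RunParams, ((datumOfRecord₁₃SepCoPHAx F 2 (gaussPinH (Stage13HParams.ofHistoryBlind F 2 ⟨theta13OfThm1CCMWZBAx F 2 j γ a₀ ε₀ ε₂₉ B₃ B₃' a₀ a₁ (Efl F j γ ε₀ ε₂₉ B₃ B₃' a₀ a₁) (fun p i => Real.log (B16ZLower.zNorm (SU 2) (gOfRecord₁₃Ax F 2 (theta13OfThm1CCMWZBAx F 2 j γ a₀ ε₀ ε₂₉ B₃ B₃' a₀ a₁ (fun _ _ => 0) (fun _ _ => 0)) p i ^ 2) ε)), ZrOfRecord₁₃Ax F 2 (theta13OfThm1CCMWZBAx F 2 j γ a₀ ε₀ ε₂₉ B₃ B₃' a₀ a₁ (Efl F j γ ε₀ ε₂₉ B₃ B₃' a₀ a₁) (fun p i => Real.log (B16ZLower.zNorm (SU 2) (gOfRecord₁₃Ax F 2 (theta13OfThm1CCMWZBAx F 2 j γ a₀ ε₀ ε₂₉ B₃ B₃' a₀ a₁ (fun _ _ => 0) (fun _ _ => 0)) p i ^ 2) ε)))⟩)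 (chiFixed29Ax F 2 (numerics7OfThm1CCM F.L j ε₀ B₃ B₃' a₀ a₁) ε₂₉)) hP).C P).flow.InInterval γ₁₃ P.K → ∀ k, k + 1 ≤ P.K → SLaw₁₃CoPHChi F 2 (gaussPinH (Stage13HParams.ofHistoryBlind F 2 ⟨theta13OfThm1CCMWZBAx F 2 j γ a₀ ε₀ ε₂₉ B₃ B₃' a₀ a₁ (Efl F j γ ε₀ ε₂₉ B₃ B₃' a₀ a₁) (fun p i => Real.log (B16ZLower.zNorm (SU 2) (gOfRecord₁₃Ax F 2 (theta13OfThm1CCMWZBAx F 2 j γ a₀ ε₀ ε₂₉ B₃ B₃' a₀ a₁ (fun _ _ => 0) (fun _ _ => 0)) p i ^ 2) ε)), ZrOfRecord₁₃Ax F 2 (theta13OfThm1CCMWZBAx F 2 j γ a₀ ε₀ ε₂₉ B₃ B₃' a₀ a₁ (Efl F j γ ε₀ ε₂₉ B₃ B₃' a₀ a₁) (fun p i => Real.log (B16ZLower.zNorm (SU 2) (gOfRecord₁₃Ax F 2 (theta13OfThm1CCMWZBAx F 2 j γ a₀ ε₀ ε₂₉ B₃ B₃' a₀ a₁ (fun _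 _ => 0) (fun _ _ => 0)) p i ^ 2) ε)))⟩) (chiFixed29Ax F 2 (numerics7OfThm1CCM F.L j ε₀ B₃ B₃' a₀ a₁) ε₂₉)) (chiFixed29Ax F 2 (numerics7OfThm1CCM F.L j ε₀ B₃ B₃' a₀ a₁) ε₂₉) P (k + 1) →
      ∀ᵐ U ∂(fieldMeasure (F.P P.K) (k + 1) (SU 2)),
        chiβOfRecord₁₃Ax F 2 (theta13OfThm1CCMWZBAx F 2 j γ a₀ ε₀ ε₂₉ B₃ B₃' a₀ a₁ (Efl F j γ ε₀ ε₂₉ B₃ B₃' a₀ a₁) (fun p i => Real.log (B16ZLower.zNorm (SU 2) (gOfRecord₁₃Ax F 2 (theta13OfThm1CCMWZBAx F 2 j γ a₀ ε₀ ε₂₉ B₃ B₃' a₀ a₁ (fun _ _ => 0) (fun _ _ => 0)) p i ^ 2) ε))) P.K (gOfRecord₁₃Ax F 2 (theta13OfThm1CCMWZBAx F 2 j γ a₀ ε₀ ε₂₉ B₃ B₃' a₀ a₁ (Efl F j γ ε₀ ε₂₉ B₃ B₃' a₀ a₁) (fun p i => Real.log (B16ZLower.zNorm (SU 2) (gOfRecord₁₃Ax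 F 2 (theta13OfThm1CCMWZBAx F 2 j γ a₀ ε₀ ε₂₉ B₃ B₃' a₀ a₁ (fun _ _ => 0) (fun _ _ => 0)) p i ^ 2) ε))) P) (k + 1) U *
              Real.exp (-(1 / (gOfRecord₁₃Ax F 2 (theta13OfThm1CCMWZBAx F 2 j γ a₀ ε₀ ε₂₉ B₃ B₃' a₀ a₁ (Efl F j γ ε₀ ε₂₉ B₃ B₃' a₀ a₁) (fun p i => Real.log (B16ZLower.zNorm (SU 2) (gOfRecord₁₃Ax F 2 (theta13OfThm1CCMWZBAx F 2 j γ a₀ ε₀ ε₂₉ B₃ B₃' a₀ a₁ (fun _ _ => 0) (fun _ _ => 0)) p i ^ 2) ε))) P (k + 1)) ^ 2 * wilsonBGOfRecord F 2 (theta13OfThm1CCMWZBAx F 2 j γ a₀ ε₀ ε₂₉ B₃ B₃' a₀ a₁ (Efl F j γ ε₀ ε₂₉ B₃ B₃' a₀ a₁) (fun p i => Real.log (B16ZLower.zNorm (SU 2) (gOfRecord₁₃Ax F 2 (theta13OfThm1CCMWZBAx F 2 j γ a₀ ε₀ ε₂₉ B₃ B₃' a₀ a₁ (fun _ _ => 0)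 (fun _ _ => 0)) p i ^ 2) ε))).εbg P (k + 1) U)
                - em (gOfRecord₁₃Ax F 2 (theta13OfThm1CCMWZBAx F 2 j γ a₀ ε₀ ε₂₉ B₃ B₃' a₀ a₁ (Efl F j γ ε₀ ε₂₉ B₃ B₃' a₀ a₁) (fun p i => Real.log (B16ZLower.zNorm (SU 2) (gOfRecord₁₃Ax F 2 (theta13OfThm1CCMWZBAx F 2 j γ a₀ ε₀ ε₂₉ B₃ B₃' a₀ a₁ (fun _ _ => 0) (fun _ _ => 0)) p i ^ 2) ε))) P (k + 1)) * (Fintype.card (Site (F.P P.K) (k + 1)) : ℝ)) ≤ densOfRecord₁₃Chi F 2 (theta13OfThm1CCMWZBAx F 2 j γ a₀ ε₀ ε₂₉ B₃ B₃' a₀ a₁ (Efl F j γ ε₀ ε₂₉ B₃ B₃' a₀ a₁) (fun p i => Real.log (B16ZLower.zNorm (SU 2) (gOfRecord₁₃Ax F 2 (theta13OfThm1CCMWZBAx F 2 j γ a₀ ε₀ ε₂₉ B₃ B₃' a₀ a₁ (fun _ _ => 0) (fun _ _ => 0)) p i ^ 2) ε))) (chiFixed29Ax F 2 (numerics7OfThm1CCM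 F.L j ε₀ B₃ B₃' a₀ a₁) ε₂₉) P (k + 1) U ∧
          densOfRecord₁₃Chi F 2 (theta13OfThm1CCMWZBAx F 2 j γ a₀ ε₀ ε₂₉ B₃ B₃' a₀ a₁ (Efl F j γ ε₀ ε₂₉ B₃ B₃' a₀ a₁) (fun p i => Real.log (B16ZLower.zNorm (SU 2) (gOfRecord₁₃Ax F 2 (theta13OfThm1CCMWZBAx F 2 j γ a₀ ε₀ ε₂₉ B₃ B₃' a₀ a₁ (fun _ _ => 0) (fun _ _ => 0)) p i ^ 2) ε))) (chiFixed29Ax F 2 (numerics7OfThm1CCM F.L j ε₀ B₃ B₃' a₀ a₁) ε₂₉) P (k + 1) U ≤ Real.exp (ep (gOfRecord₁₃Ax F 2 (theta13OfThm1CCMWZBAx F 2 j γ a₀ ε₀ ε₂₉ B₃ B₃' a₀ a₁ (Efl F j γ ε₀ ε₂₉ B₃ B₃' a₀ a₁) (fun p i => Real.log (B16ZLower.zNorm (SU 2) (gOfRecord₁₃Ax F 2 (theta13OfThm1CCMWZBAx F 2 j γ a₀ ε₀ ε₂₉ B₃ B₃' a₀ a₁ (fun _ _ => 0) (fun _ _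 => 0)) p i ^ 2) ε))) P (k + 1)) * (Fintype.card (Site (F.P P.K) (k + 1)) : ℝ))))
    -- ★ THE COFINAL β-SOCKET (director-ym №402 (R) ∕ P3 g84 spec (R1)): K0⁷'s sign-free β-BOX AND NODE O's four RUN ROWS AT A RADIUS SUPPLIED BY THE PRODUCER — for every ceiling `a > 0` SOME
    -- `0 < a₀ ≤ a`, SOME member letters `(j, ε₀, B₃, B₃′, a₁, Efl, logz)`, level `γ₀`, threshold `ε₂₉`, bound `β′` with the abs box of β₁₃ at the doors' HALF-WINDOW Z3 member
    -- (= the body of `K0V23Stub3DoorSuppliers.K0BoxCofinalRadii` ✓p781725 at `F`, conjunct for conjunct) ∧ NODE O's rows (i) (iv) (C) at THAT β at SOME level `γ₁` (K1⁹'s own rows conjunct);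
    -- replaces engine v2's `h3` (the ∀-radius V23 stub text) AND `hrowsRF` (the ∀-door run rows): the socket bills the producer at ITS radius, not at every small radius
    (hβc : ∀ F : T4Family, ∀ a : ℝ, 0 < a → ∃ a₀ : ℝ, 0 < a₀ ∧ a₀ ≤ a ∧
      ∃ (γ₀ ε₂₉ β' : ℝ) (j : ℕ) (ε₀ B₃ B₃' a₁ : ℝ) (Efl logz : B12.RunParams → ℕ → ℝ), 0 < γ₀ ∧ 0 < ε₂₉ ∧
        BetaLowerH (-β') γ₀ (betaOfRecord₁₃Ax F 2 (theta13OfThm1CCMWZBAx F 2 j (1 / 2) a₀ ε₀ ε₂₉ B₃ B₃' a₀ a₁ Efl logz)) ∧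
        BetaUpperH β' γ₀ (betaOfRecord₁₃Ax F 2 (theta13OfThm1CCMWZBAx F 2 j (1 / 2) a₀ ε₀ ε₂₉ B₃ B₃' a₀ a₁ Efl logz)) ∧
        ∃ (b : ℕ → ℝ) (r γ₁ M : ℝ), 0 < γ₁ ∧
          (∀ (n : ℕ) (gs : ℕ → ℝ), RGEqH n (betaOfRecord₁₃Ax F 2 (theta13OfThm1CCMWZBAx F 2 j (1 / 2) a₀ ε₀ ε₂₉ B₃ B₃' a₀ a₁ Efl logz)) gs → Step.InInterval γ₁ n gs → ∀ k, k ≤ n → |betaOfRecord₁₃Ax F 2 (theta13OfThm1CCMWZBAx F 2 j (1 / 2) a₀ ε₀ ε₂₉ B₃ B₃' a₀ a₁ Efl logz) k (prefixOf gs k) - b k| ≤ r) ∧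
          (∀ (n : ℕ) (gs : ℕ → ℝ), RGEqH n (betaOfRecord₁₃Ax F 2 (theta13OfThm1CCMWZBAx F 2 j (1 / 2) a₀ ε₀ ε₂₉ B₃ B₃' a₀ a₁ Efl logz)) gs → Step.InInterval γ₁ n gs → ∀ k, k ≤ n → -M ≤ ∑ i ∈ Finset.Ico k n, betaOfRecord₁₃Ax F 2 (theta13OfThm1CCMWZBAx F 2 j (1 / 2) a₀ ε₀ ε₂₉ B₃ B₃' a₀ a₁ Efl logz) i (prefixOf gs i)) ∧
          ∀ k : ℕ, ContinuousOn (fun x : ℝ => betaOfRecord₁₃Ax F 2 (theta13OfThm1CCMWZBAx F 2 j (1 / 2) a₀ ε₀ ε₂₉ B₃ B₃' a₀ a₁ Efl logz) k (clampPrefix (betaOfRecord₁₃Ax F 2 (theta13OfThm1CCMWZBAx F 2 j (1 / 2) a₀ ε₀ ε₂₉ B₃ B₃' a₀ a₁ Efl logz)) γ₁ k x))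
            {x : ℝ | 0 < x ∧ x ≤ γ₁ ∧ ∀ i, i ≤ k → 1 / γ₁ ^ 2 ≤ Y (betaOfRecord₁₃Ax F 2 (theta13OfThm1CCMWZBAx F 2 j (1 / 2) a₀ ε₀ ε₂₉ B₃ B₃' a₀ a₁ Efl logz)) γ₁ i x}) :
    Summit.QuantumFields.YangMills.Theses.BalabanUVNodes.StabilityBRunRowsAtRecordR13SepCoPHVAx := by
  intro F _
  exact N24_k1AxBodyAt_line2VW_of_cofinalBetaSocketZBV23_of_childrenS_N12Pin_N09RowsAxDoorN11SupplierRowsThm1AEPos_atGaussPinPrintedZB ε hεz (Efl F)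
    (h05 F) (h06 F) (h07 F) (h08 F) (h09 F) (h09R F) (h10 F) (h11N F) (h12 F) (hEfl F) (h13pos F) (hβc F)

end Summit.QuantumFields.YangMills.BalabanUVNodes.N24K1AxLine2VWN09TAxAtCofinalBetaSocketGaussPinPrintedZBY

end
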